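/-
Copyright (c) 2026 the pub-hodgecm-mathlib formalisation cell (harness21).  Prover seat hodgecm-mathlib-F0P3a-p04 (g20): road «S3-ram» (LEAD F0P3a-plan (g13);
(Cnt2′) chair F0P3a-p07 (g15) RULING (14) (1); (α) block-law keeper F0P3a-p06 (g16)), organ «(K2-even) THE A-EVEN ANISOTROPIC ROOT: ALL GRANDCHILDREN ARE `O`»; 2026-09-02.
-/
import Literature.NumberTheory.Automorphic.UnitaryLatticeTreeTubeCollarAnisotropicRoot      -- ★ (L2) p849201 (F0P2-p01 (g16)): `exists_generator_of_anisotropicRoot_sandwich`, `anisotropicRoot_fixed_and_lev_iff`; brings ★ p848920 (p08) `setOf_selfDual_fixed_lev_eq_singleton_of_anisotropic`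
import Literature.NumberTheory.Automorphic.UnitaryLatticeTreeAnisotropicBlockNonContraction   -- ★ (z6-g) p848962∕p849100 (F0P3a-p08 (g20)): `nonContraction_of_unitary_anisotropic_of_entry`
import Literature.NumberTheory.Automorphic.UnitaryLatticeTreeAxisEndoFrame                     -- ★ (z1-a) p847645: `coe_endoGL_sub_one_eq_endoShape`, `endoShape_mul_endoShape`
import Literature.NumberTheory.Automorphic.UnitaryLatticeTreeFormTransport                     -- ★ G4 (F0P3a-p01): `map_conj_sub_one_le_scaleLattice_iff`, `map_conj_sub_one_sq_le_scaleLattice_iff`; brings ★ FrameChange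
import Literature.NumberTheory.Automorphic.UnitaryLatticeTreeRegionGrandchildLabelsOfRootRamified -- ★ p848574 (F0P2-p02 (g14)): `scaleLattice_le_of_adj_adj_of_isSelfDualLattice` (the two-step sandwich)
import Literature.NumberTheory.Automorphic.UnitaryLatticeTreeRootSliceCountRamified            -- ★ ROW-ROOT-SLICE (F0P2-p06 (g13)): `ncard_rootGrandchildren_sep_eq_mul_ncard_of_congr_sq` (ED. 2 §5); brings ★ `ncard_neighborSet_root_of_ramified`
import HarnessLib

/-!
# The lattice tree of the ramified `U(3)`: THE ANISOTROPIC ROOT AT EVEN DEPTH — every grandchild of the root is of type `O` (all child lines are NULL, no eigenline, no `LEV₂`)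
# (Bruhat–Tits 1972 §10; Labesse–Langlands 1979 §2; Kottwitz 1986 §3; Rogawski 1990 §4.9)

Topic `NumberTheory/Automorphic`; namespace `Literature.NumberTheory.Automorphic.UnitaryLatticeTree`.  THEOREMS ONLY (no definition, no instance, no notation, no named fact,
no `sorry`); kernel lane `--supports stmt-HodgeConjecture-24833`; datum-free (`K` with `Valued K ℤᵐ⁰`, `σϖ = −ϖ`, `σ̄ = id`, `|2| = 1`).  Cell `pub/hodgecm-mathlib` (D-0151),
crux H413; road «S3-ram» (Literature seeding, count-neutral); (T2) G-side organ (Cnt2′) of the fold, the (α) block-law skeleton's ANISOTROPIC totals (composition pen A-p16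
(g33), ★ `…AnisotropicTotalsEven`), branch **A-even** (`N = 2n = d₀ = 2mA + 2`, the `u`-line DEEPER than the block: `d_u > N`, `|½tr γ₁ − u| < |ϖ|^{d₀}`): the census
atoms `(NE, NO, NP, NM)` of ★ `strataCount_J₀_of_charpoly_block_even_singleton` (F0P3-p03 (g16), p848995) at the anisotropic literal are **`(0, #GC(r₀), 0, 0)`** — «all
`(q+1)q` root grandchildren are `O_{mA}`» (p03 (g18) REGIME TABLE `Z(t₁) = e₀ + (q+1)q·S(O_{n−1})`; B-p14 (g40) MEMO v2 (L2); F0P3a-p02 (g18) CENSUS NOTE v1).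

THE MECHANISM («the even-parity congruence», A-p12 (g25) 04:28:18Z).  Block model `H = ι(diag d, η)` anisotropic (`hanis`), `Γ = ι(γ₁, u)`, root `L₀ = 𝒪³` of level `D`
(EVEN) for `Γ − 1`, bottom `|tr(γ₁)² − 4det(γ₁)| = |ϖ|^{2D}`, line part `|u₀₀ − 1| < |ϖ|^D`:
* (§1) at EVEN depth the first-order unitarity relation is `ᵗT̄·D̄ + D̄·T̄ = 0` (`σ(ϖ^D) = +ϖ^D`): `D̄T̄` is ANTISYMMETRIC, so the residual diagonal of `T = ϖ^{−D}(γ₁−1)` vanishes and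
  the residual value `ϖ^{−D}⟨z,(Γ−1)z⟩` VANISHES on all of `𝒪³` (`v_pairing_diagonal_sub_one_lt_of_even`, `v_inv_pow_mul_pairing_endoShape_lt_one`) ⇒ by ★ (L2)
  `anisotropicRoot_fixed_and_lev_iff` EVERY root grandchild has `LEV(ϖ^{D−1})`;
* (§2) at the bottom `⟨z,(Γ−1)²z⟩` has valuation EXACTLY `|ϖ|^{2D}` on the collar generator (`v_pairing_sub_one_sq_eq_of_bottom`), so NO root grandchild has `LEV₂(ϖ^{2D−1})`
  (`not_forall_sub_one_sq_mulVec_mem_scaleLattice_of_bottom`) — the grandchildren are of RANK 2, type `O`, not `P^±`;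
* (§3) `¬LEV(ϖ^D)` off the root is ★ p08's singleton root region (★ `setOf_selfDual_fixed_lev_eq_singleton_of_anisotropic` ∘ ★ `nonContraction_of_unitary_anisotropic_of_entry`,
  the entry `|(γ₁ − u₀₀)₀₁| = |ϖ|^D` coming from the bottom); assembled: **`anisotropicRoot_tokens_of_even_bottom`** (block model, SET currency: every self-dual `Γ`-fixed
  `w ≠ L₀` with `ϖL₀ ≤ w`, `ϖw ≤ L₀` satisfies `¬LEV(ϖ^D) ∧ LEV(ϖ^{D−1}) ∧ LEV(ϖ^{D−2}) ∧ ¬LEV₂(ϖ^{2D−1})`, map form);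
* (§4) the `Φ₃`∕`J₀`-MODEL CENSUS for `γ = P·ι(γ₁,u)·P⁻¹ ∈ U(σ,J₀) ∩ K₀` (★ p08 §3 transport pattern: ★ `isSelfDualLattice_formCongr_iff`, ★ `map_conj_sub_one[_sq]_le_scaleLattice_iff`,
  ★ `mapGL_conj_mapGL_eq_iff`; the `J₀`-graph supplies self-duality and the sandwich of a grandchild): **`anisotropicRoot_even_census_of_coe_eq_conj_endoGL`** — in ★ p848995's
  `hNE hNO hNP hNM` set-builder texts VERBATIM: `#E = 0`, `#P = 0`, `#M = 0`, `#O = #GC(r₀)` (the `O`-set IS the grandchild set).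
HONEST LABEL: HC_CM is proved only modulo the 2 remaining named inputs (hLiu418 24832, h413 24833) until rung 0 closes; nothing printed is asserted here (valuation algebra and
lattice bookkeeping over ★ results); «S3-ram» has no books consequence.

## References
* [BruhatTits1972] F. Bruhat, J. Tits, *Groupes réductifs sur un corps local I*, Publ. Math. IHÉS 41 (1972), §10 (lattice models; vertex stabilisers).
* [LabesseLanglands1979] J.-P. Labesse, R. P. Langlands, *L-indistinguishability for SL(2)*, Canad. J. Math. 31 (1979), §2 (the rank-2 block at the two classes).
* [Kottwitz1986] R. E. Kottwitz, *Base change for unit elements of Hecke algebras*, Compositio Math. 60 (1986), §3 (levels of fixed lattices, shell by shell).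
* [Rogawski1990] J. D. Rogawski, *Automorphic Representations of Unitary Groups in Three Variables*, Ann. of Math. Stud. 123 (1990), §4.8 Case (a) p. 53, §4.9 Prop. 4.9.1 (b)
  p. 55, Lemma 4.9.3 p. 56 (the strata of the ramified orbital integrals).
-/

set_option autoImplicit false

noncomputable section

open scoped Valued WithZero Matrix MatrixGroups
open Literature.NumberTheory.Automorphic Literature.NumberTheory.Automorphic.HermitianLattice Literature.NumberTheory.Automorphic.UnitaryLatticeTree
open Literature.NumberTheory.Rogawski1990 Literature.NumberTheory.Automorphic.UnitaryGroup

namespace Literature.NumberTheory.Automorphic.UnitaryLatticeTree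

variable {K : Type*} [Field K] [Valued K ℤᵐ⁰] {σ : K →+* K} {ϖ : K}

/-! ## §1 Even depth: the residual value of `Γ − 1` vanishes identically -/

/-- **EVEN-DEPTH UNITARITY KILLS THE RESIDUAL VALUE** (rank `2`, diagonal unit form `diag(d₀,d₁)`): for `g ∈ U(σ, diag d)` with `|g − 1| ≤ |ϖ|^D` entrywise at EVEN
depth `D ≠ 0`, writing `T = ϖ^{−D}(g − 1)`: (i) the residual DIAGONAL vanishes, `|Tᵢᵢ| < 1` (entry `(i,i)` of `ᵗ(σg)·diag d·g = diag d` reads `σTᵢᵢ + Tᵢᵢ = −ϖ^D(…)` since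
`σ(ϖ^D) = +ϖ^D`, and `|σTᵢᵢ − Tᵢᵢ| < 1`), (ii) the residual VALUE vanishes on every integral vector, `|ϖ^{−D}⟨y,(g−1)y⟩| < 1` (the cross term is `d₁(a − σa) − ϖ^D(…)` by the
`(0,1)` entry, `a = σ(y₁)y₀T₁₀`) — `diag(d)·T̄` is ANTISYMMETRIC; the even-parity twin of ★ `residue_apply_eq_and_offDiag_dichotomy_of_unitary_two` (odd: symmetric).
[cite: LabesseLanglands1979, §2] [cite: Kottwitz1986, §3] [cite: Rogawski1990, §4.9 Lemma 4.9.3 p. 56] -/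
theorem v_pairing_diagonal_sub_one_lt_of_even (hσ : ∀ a, σ (σ a) = a) (hvσ : ∀ a, Valued.v (σ a) = Valued.v a) (hσϖ : σ ϖ = -ϖ)
    (hϖ : Valued.v ϖ = WithZero.exp (-1 : ℤ)) (hres : ∀ x : K, Valued.v x ≤ 1 → Valued.v (σ x - x) < 1) (h2 : Valued.v (2 : K) = 1)
    {d : Fin 2 → K} (hd : ∀ i, Valued.v (d i) = 1)
    (g : Matrix (Fin 2) (Fin 2) K) (hg : (g.map σ)ᵀ * Matrix.diagonal d * g = Matrix.diagonal d)
    {D : ℕ} (hD : Even D) (hD0 : D ≠ 0) (hdeep : ∀ i j, Valued.v ((g - 1) i j) ≤ Valued.v ϖ ^ D) :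
    (∀ i, Valued.v ((ϖ ^ D)⁻¹ * (g - 1) i i) < 1) ∧
    ∀ y : Fin 2 → K, (∀ i, Valued.v (y i) ≤ 1) →
      Valued.v ((ϖ ^ D)⁻¹ * pairing σ (Matrix.diagonal d) y ((g - 1) *ᵥ y)) < 1 := by
  have hϖ0 : ϖ ≠ 0 := fun h0 => by rw [h0, map_zero] at hϖ; exact WithZero.coe_ne_zero hϖ.symm
  have hϖD0 : (ϖ ^ D : K) ≠ 0 := pow_ne_zero _ hϖ0
  have hϖ1 : Valued.v ϖ < 1 := by rw [hϖ, ← WithZero.exp_zero]; exact WithZero.exp_lt_exp.2 (by norm_num)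
  have hϖD1 : Valued.v (ϖ ^ D) ≤ 1 := by rw [map_pow]; exact pow_le_one₀ zero_le hϖ1.le
  have hvD : Valued.v ((ϖ ^ D)⁻¹ : K) * Valued.v ϖ ^ D = 1 := by rw [← map_pow, ← map_mul, inv_mul_cancel₀ hϖD0, map_one]
  -- the integral matrix `T = ϖ^{-D}(g − 1)`
  have hTint : ∀ i j, Valued.v ((ϖ ^ D)⁻¹ * (g - 1) i j) ≤ 1 := fun i j => by
    rw [map_mul]
    calc Valued.v ((ϖ ^ D)⁻¹ : K) * Valued.v ((g - 1) i j) ≤ Valued.v ((ϖ ^ D)⁻¹ : K) * Valued.v ϖ ^ D := by gcongr; exact hdeep i j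
      _ = 1 := hvD
  set T : Fin 2 → Fin 2 → K := fun i j => (ϖ ^ D)⁻¹ * (g - 1) i j with hTdef
  have hT : ∀ i j, Valued.v (T i j) ≤ 1 := hTint
  have hTσ : ∀ i j, Valued.v (σ (T i j)) ≤ 1 := fun i j => by rw [hvσ]; exact hT i j
  have hent : ∀ i j, g i j = (1 : Matrix (Fin 2) (Fin 2) K) i j + ϖ ^ D * T i j := fun i j => by
    simp only [hTdef, mul_inv_cancel_left₀ hϖD0, Matrix.sub_apply]; ring
  have h00 := hent 0 0; have h01 := hent 0 1; have h10 := hent 1 0; have h11 := hent 1 1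
  simp only [Matrix.one_apply_eq, Matrix.one_apply_ne (show (0 : Fin 2) ≠ 1 by decide),
    Matrix.one_apply_ne (show (1 : Fin 2) ≠ 0 by decide), zero_add] at h00 h01 h10 h11
  have hσϖD : σ (ϖ ^ D) = ϖ ^ D := by rw [map_pow, hσϖ, hD.neg_pow]
  -- the four entries of the unitarity relation
  have hu := fun i j => congrArg (fun A => A i j) hg
  have hu00 := hu 0 0; have hu01 := hu 0 1; have hu11 := hu 1 1
  simp only [Matrix.mul_apply, Fin.sum_univ_two, Matrix.transpose_apply, Matrix.map_apply, Matrix.diagonal_apply_eq,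
    Matrix.diagonal_apply_ne _ (show (0 : Fin 2) ≠ 1 by decide), Matrix.diagonal_apply_ne _ (show (1 : Fin 2) ≠ 0 by decide),
    mul_zero, add_zero, zero_add] at hu00 hu01 hu11
  simp only [h00, h01, h10, h11, map_add, map_one, map_mul, hσϖD] at hu00 hu01 hu11
  -- (0,0): d₀(σT₀₀ + T₀₀) = −ϖ^D(...)
  have k00 : σ (T 0 0) + T 0 0 = -(ϖ ^ D) * (σ (T 0 0) * T 0 0 + (d 0)⁻¹ * d 1 * (σ (T 1 0) * T 1 0)) := by
    have hd0 : d 0 ≠ 0 := fun h0 => by have := hd 0; rw [h0, map_zero] at this; exact zero_ne_one this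
    have := hu00
    field_simp
    apply mul_left_cancel₀ hϖD0
    linear_combination this
  have k11 : σ (T 1 1) + T 1 1 = -(ϖ ^ D) * (σ (T 1 1) * T 1 1 + (d 1)⁻¹ * d 0 * (σ (T 0 1) * T 0 1)) := by
    have hd1 : d 1 ≠ 0 := fun h0 => by have := hd 1; rw [h0, map_zero] at this; exact zero_ne_one this
    have := hu11
    field_simp
    apply mul_left_cancel₀ hϖD0
    linear_combination this
  have k01 : d 0 * T 0 1 + d 1 * σ (T 1 0) = -(ϖ ^ D) * (d 0 * σ (T 0 0) * T 0 1 + d 1 * σ (T 1 0) * T 1 1) := by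
    have := hu01
    apply mul_left_cancel₀ hϖD0
    linear_combination this
  have hϖDlt : Valued.v (ϖ ^ D) < 1 := by rw [map_pow]; exact pow_lt_one₀ zero_le hϖ1 hD0
  have hd0 : d 0 ≠ 0 := fun h0 => by have := hd 0; rw [h0, map_zero] at this; exact zero_ne_one this
  have hd1 : d 1 ≠ 0 := fun h0 => by have := hd 1; rw [h0, map_zero] at this; exact zero_ne_one this
  -- (i) the residual diagonal vanishes: |σ t + t| ≤ |ϖ|^D and |σ t − t| < 1 ⇒ |2t| < 1
  have key : ∀ t s : K, Valued.v t ≤ 1 → σ t + t = -(ϖ ^ D) * s → Valued.v s ≤ 1 → Valued.v t < 1 := by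
    intro t s ht hts hs
    have h1 : Valued.v (σ t + t) < 1 := by
      rw [hts, map_mul, Valuation.map_neg]
      calc Valued.v (ϖ ^ D) * Valued.v s ≤ Valued.v (ϖ ^ D) * 1 := by gcongr
        _ < 1 := by rw [mul_one]; exact hϖDlt
    have h2' : Valued.v (σ t - t) < 1 := hres t ht
    have : (2 : K) * t = (σ t + t) - (σ t - t) := by ring
    have h3 : Valued.v ((2 : K) * t) < 1 := by rw [this]; exact (Valued.v.map_sub _ _).trans_lt (max_lt h1 h2')
    rwa [map_mul, h2, one_mul] at h3
  have hT00 : Valued.v (T 0 0) < 1 := by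
    refine key (T 0 0) _ (hT 0 0) k00 ?_
    refine (Valued.v.map_add _ _).trans (max_le ?_ ?_)
    · rw [map_mul]; exact mul_le_one' (hTσ 0 0) (hT 0 0)
    · rw [map_mul, map_mul, map_mul, map_inv₀, hd 0, hd 1, inv_one, one_mul, one_mul]; exact mul_le_one' (hTσ 1 0) (hT 1 0)
  have hT11 : Valued.v (T 1 1) < 1 := by
    refine key (T 1 1) _ (hT 1 1) k11 ?_
    refine (Valued.v.map_add _ _).trans (max_le ?_ ?_)
    · rw [map_mul]; exact mul_le_one' (hTσ 1 1) (hT 1 1)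
    · rw [map_mul, map_mul, map_mul, map_inv₀, hd 0, hd 1, inv_one, one_mul, one_mul]; exact mul_le_one' (hTσ 0 1) (hT 0 1)
  refine ⟨fun i => by fin_cases i <;> assumption, fun y hy => ?_⟩
  -- (ii) the value: diagonal terms are small by (i), the cross terms are `d₁(a − σa) − ϖ^D(…)` by the `(0,1)` relation
  have hsub : ∀ i j, (g - 1) i j = ϖ ^ D * T i j := fun i j => by simp only [hTdef, mul_inv_cancel_left₀ hϖD0]
  have hyσ : ∀ i, Valued.v (σ (y i)) ≤ 1 := fun i => by rw [hvσ]; exact hy i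
  set a : K := σ (y 1) * y 0 * T 1 0 with ha
  have hσa : σ a = y 1 * σ (y 0) * σ (T 1 0) := by rw [ha, map_mul, map_mul, hσ]
  have hval : (ϖ ^ D)⁻¹ * pairing σ (Matrix.diagonal d) y ((g - 1) *ᵥ y) =
      d 0 * (σ (y 0) * T 0 0 * y 0) + d 1 * (σ (y 1) * T 1 1 * y 1) + d 1 * (σ (y 1) * y 0 * T 1 0 - y 1 * σ (y 0) * σ (T 1 0)) +
        -(ϖ ^ D) * (σ (y 0) * y 1 * (d 0 * σ (T 0 0) * T 0 1 + d 1 * σ (T 1 0) * T 1 1)) := by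
    rw [pairing_apply]
    simp only [Fin.sum_univ_two, Matrix.mulVec, dotProduct, Matrix.diagonal_apply_eq,
      Matrix.diagonal_apply_ne _ (show (0 : Fin 2) ≠ 1 by decide), Matrix.diagonal_apply_ne _ (show (1 : Fin 2) ≠ 0 by decide), hsub,
      mul_zero, zero_mul, add_zero, zero_add]
    field_simp
    linear_combination (σ (y 0) * y 1) * k01
  rw [hval, ← hσa, ← ha]
  have t1 : Valued.v (d 0 * (σ (y 0) * T 0 0 * y 0)) < 1 := by
    rw [map_mul, hd 0, one_mul, map_mul, map_mul]
    calc Valued.v (σ (y 0)) * Valued.v (T 0 0) * Valued.v (y 0) ≤ 1 * Valued.v (T 0 0) * 1 := by gcongr; exacts [hyσ 0, hy 0]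
      _ < 1 := by rw [one_mul, mul_one]; exact hT00
  have t2 : Valued.v (d 1 * (σ (y 1) * T 1 1 * y 1)) < 1 := by
    rw [map_mul, hd 1, one_mul, map_mul, map_mul]
    calc Valued.v (σ (y 1)) * Valued.v (T 1 1) * Valued.v (y 1) ≤ 1 * Valued.v (T 1 1) * 1 := by gcongr; exacts [hyσ 1, hy 1]
      _ < 1 := by rw [one_mul, mul_one]; exact hT11
  have haint : Valued.v a ≤ 1 := by
    rw [ha, map_mul, map_mul]; exact mul_le_one' (mul_le_one' (hyσ 1) (hy 0)) (hT 1 0)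
  have t3 : Valued.v (d 1 * (a - σ a)) < 1 := by
    rw [map_mul, hd 1, one_mul, ← neg_sub, Valuation.map_neg]; exact hres a haint
  have t4 : Valued.v (-(ϖ ^ D) * (σ (y 0) * y 1 * (d 0 * σ (T 0 0) * T 0 1 + d 1 * σ (T 1 0) * T 1 1))) < 1 := by
    rw [map_mul, Valuation.map_neg]
    refine mul_lt_one_of_lt_of_le hϖDlt ?_
    rw [map_mul]
    refine mul_le_one' (by rw [map_mul]; exact mul_le_one' (hyσ 0) (hy 1)) ((Valued.v.map_add _ _).trans (max_le ?_ ?_))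
    · rw [map_mul, map_mul, hd 0, one_mul]; exact mul_le_one' (hTσ 0 0) (hT 0 1)
    · rw [map_mul, map_mul, hd 1, one_mul]; exact mul_le_one' (hTσ 1 0) (hT 1 1)
  refine (Valued.v.map_add _ _).trans_lt (max_lt ((Valued.v.map_add _ _).trans_lt (max_lt ((Valued.v.map_add _ _).trans_lt (max_lt t1 t2)) t3)) t4)

omit [Valued K ℤᵐ⁰] in
/-- **Block decomposition of the pairing**: for the `ι`-shaped form `H = ι(diag d, η)` and an `ι`-shaped matrix `ι(A, b)`, `⟨x, ι(A,b)x⟩_H = ⟨x_W, A x_W⟩_{diag d} + σ(x₁)·η·b·x₁`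
(`x_W = (x₀, x₂)`). [cite: Rogawski1990, §4.8 Case (a) p. 53] -/
theorem pairing_endoShape_mulVec_endoShape (σ : K →+* K) (d : Fin 2 → K) (η : K) (A : Matrix (Fin 2) (Fin 2) K) (b : K) (x : Fin 3 → K) :
    pairing σ (!![(Matrix.diagonal d) 0 0, 0, (Matrix.diagonal d) 0 1; 0, η, 0; (Matrix.diagonal d) 1 0, 0, (Matrix.diagonal d) 1 1] : Matrix (Fin 3) (Fin 3) K) x
        ((!![A 0 0, 0, A 0 1; 0, b, 0; A 1 0, 0, A 1 1] : Matrix (Fin 3) (Fin 3) K) *ᵥ x) =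
      pairing σ (Matrix.diagonal d) ![x 0, x 2] (A *ᵥ ![x 0, x 2]) + σ (x 1) * η * (b * x 1) := by
  simp only [pairing_apply, Fin.sum_univ_three, Fin.sum_univ_two, Matrix.mulVec, dotProduct, Matrix.diagonal_apply_eq,
    Matrix.diagonal_apply_ne _ (show (0 : Fin 2) ≠ 1 by decide), Matrix.diagonal_apply_ne _ (show (1 : Fin 2) ≠ 0 by decide),
    Matrix.of_apply, Matrix.cons_val', Matrix.cons_val_zero, Matrix.cons_val_one, Matrix.cons_val_two, Matrix.empty_val', Matrix.cons_val_fin_one,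
    Matrix.head_cons, Matrix.tail_cons, Matrix.head_fin_const]
  ring

omit [Valued K ℤᵐ⁰] in
/-- `(ι(g,u) − 1)²` is `ι`-shaped with blocks `(g − 1)²`, `(u₀₀ − 1)²` (★ `coe_endoGL_sub_one_eq_endoShape`, ★ `endoShape_mul_endoShape`). [cite: Rogawski1990, §4.8 Case (a) p. 53] -/
theorem coe_endoGL_sub_one_sq_eq_endoShape (g : GL (Fin 2) K) (u : GL (Fin 1) K) :
    (((endoGL (g, u) : GL (Fin 3) K) : Matrix (Fin 3) (Fin 3) K) - 1) ^ 2 =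
      !![(((g : Matrix (Fin 2) (Fin 2) K) - 1) ^ 2 : Matrix (Fin 2) (Fin 2) K) 0 0, 0, (((g : Matrix (Fin 2) (Fin 2) K) - 1) ^ 2 : Matrix (Fin 2) (Fin 2) K) 0 1;
        0, ((u : Matrix (Fin 1) (Fin 1) K) 0 0 - 1) ^ 2, 0;
        (((g : Matrix (Fin 2) (Fin 2) K) - 1) ^ 2 : Matrix (Fin 2) (Fin 2) K) 1 0, 0, (((g : Matrix (Fin 2) (Fin 2) K) - 1) ^ 2 : Matrix (Fin 2) (Fin 2) K) 1 1] := by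
  rw [coe_endoGL_sub_one_eq_endoShape, pow_two, pow_two, pow_two, endoShape_mul_endoShape]

/-- **The residual value of `ι(g,u) − 1` vanishes on `𝒪³`** when the W-block value vanishes on `𝒪²` (hypothesis `hW`, e.g. §1 at even depth) and the line part is deeper than `D`
(`|ϖ^{−D}(u₀₀ − 1)| < 1`): `|ϖ^{−D}⟨z, (ι(g,u) − 1)z⟩_H| < 1` for every integral `z`.  [cite: Kottwitz1986, §3] [cite: Rogawski1990, §4.9 p. 55] -/
theorem v_inv_pow_mul_pairing_endoShape_lt_one {d : Fin 2 → K} {η : K} (hη : Valued.v η ≤ 1) (hvσ : ∀ a, Valued.v (σ a) = Valued.v a)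
    (g : GL (Fin 2) K) (u : GL (Fin 1) K) {D : ℕ}
    (hW : ∀ y : Fin 2 → K, (∀ i, Valued.v (y i) ≤ 1) →
      Valued.v ((ϖ ^ D)⁻¹ * pairing σ (Matrix.diagonal d) y ((((g : Matrix (Fin 2) (Fin 2) K)) - 1) *ᵥ y)) < 1)
    (hu : Valued.v ((ϖ ^ D)⁻¹ * ((u : Matrix (Fin 1) (Fin 1) K) 0 0 - 1)) < 1)
    (z : Fin 3 → K) (hz : ∀ i, Valued.v (z i) ≤ 1) :
    Valued.v ((ϖ ^ D)⁻¹ * pairing σ (!![(Matrix.diagonal d) 0 0, 0, (Matrix.diagonal d) 0 1; 0, η, 0; (Matrix.diagonal d) 1 0, 0, (Matrix.diagonal d) 1 1] : Matrix (Fin 3) (Fin 3) K) z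
        (((((endoGL (g, u) : GL (Fin 3) K)) : Matrix (Fin 3) (Fin 3) K) - 1) *ᵥ z)) < 1 := by
  rw [coe_endoGL_sub_one_eq_endoShape, pairing_endoShape_mulVec_endoShape, mul_add]
  refine (Valued.v.map_add _ _).trans_lt (max_lt (hW _ fun i => by fin_cases i <;> simp [hz]) ?_)
  have : (ϖ ^ D)⁻¹ * (σ (z 1) * η * (((u : Matrix (Fin 1) (Fin 1) K) 0 0 - 1) * z 1)) = σ (z 1) * η * z 1 * ((ϖ ^ D)⁻¹ * ((u : Matrix (Fin 1) (Fin 1) K) 0 0 - 1)) := by ring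
  rw [this, map_mul, mul_comm]
  refine mul_lt_one_of_lt_of_le hu ?_
  rw [map_mul, map_mul, hvσ]
  exact mul_le_one' (mul_le_one' (hz 1) hη) (hz 1)

/-! ## §2 The bottom: `⟨z,(Γ−1)²z⟩` has exact valuation `|ϖ|^{2D}` — no `LEV₂(ϖ^{2D−1})` on the collar -/

/-- **AT THE BOTTOM THE SQUARE HAS EXACT VALUATION**: for a `2 × 2` block `g` with `|g − 1| ≤ |ϖ|^D`, residually vanishing diagonal of `T = ϖ^{−D}(g−1)` and
`|tr(g)² − 4det(g)| = |ϖ|^{2D}` EXACTLY (the W-block sits at the BOTTOM of its fixed ball), `⟨y, (g−1)² y⟩_{diag d}` has valuation EXACTLY `|ϖ|^{2D}` on every integral `y` of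
unit norm `|⟨y,y⟩| = 1`: `tr² − 4det = ϖ^{2D}((t₀₀−t₁₁)² + 4t₀₁t₁₀)` forces `|t₀₁t₁₀| = 1`, and `⟨y,(g−1)²y⟩ = ϖ^{2D}(t₀₁t₁₀·⟨y,y⟩ + E)` with `|E| < 1`.
[cite: Kottwitz1986, §3] [cite: Rogawski1990, §4.9 Lemma 4.9.3 p. 56] -/
theorem v_pairing_sub_one_sq_eq_of_bottom (hvσ : ∀ a, Valued.v (σ a) = Valued.v a)
    (hϖ : Valued.v ϖ = WithZero.exp (-1 : ℤ)) (h2 : Valued.v (2 : K) = 1)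
    {d : Fin 2 → K} (hd : ∀ i, Valued.v (d i) = 1)
    (g : Matrix (Fin 2) (Fin 2) K) {D : ℕ} (hdeep : ∀ i j, Valued.v ((g - 1) i j) ≤ Valued.v ϖ ^ D)
    (hdiag : ∀ i, Valued.v ((ϖ ^ D)⁻¹ * (g - 1) i i) < 1)
    (hdisc : Valued.v (g.trace ^ 2 - 4 * g.det) = Valued.v ϖ ^ (2 * D))
    (y : Fin 2 → K) (hy : ∀ i, Valued.v (y i) ≤ 1) (hyy : Valued.v (pairing σ (Matrix.diagonal d) y y) = 1) :
    Valued.v (pairing σ (Matrix.diagonal d) y (((g - 1) ^ 2) *ᵥ y)) = Valued.v ϖ ^ (2 * D) := by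
  have hϖ0 : ϖ ≠ 0 := fun h0 => by rw [h0, map_zero] at hϖ; exact WithZero.coe_ne_zero hϖ.symm
  have hϖD0 : (ϖ ^ D : K) ≠ 0 := pow_ne_zero _ hϖ0
  have hvD : Valued.v ((ϖ ^ D)⁻¹ : K) * Valued.v ϖ ^ D = 1 := by rw [← map_pow, ← map_mul, inv_mul_cancel₀ hϖD0, map_one]
  set T : Fin 2 → Fin 2 → K := fun i j => (ϖ ^ D)⁻¹ * (g - 1) i j with hTdef
  have hT : ∀ i j, Valued.v (T i j) ≤ 1 := fun i j => by
    simp only [hTdef]; rw [map_mul]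
    calc Valued.v ((ϖ ^ D)⁻¹ : K) * Valued.v ((g - 1) i j) ≤ Valued.v ((ϖ ^ D)⁻¹ : K) * Valued.v ϖ ^ D := by gcongr; exact hdeep i j
      _ = 1 := hvD
  have hT00 : Valued.v (T 0 0) < 1 := hdiag 0
  have hT11 : Valued.v (T 1 1) < 1 := hdiag 1
  have hsub : ∀ i j, (g - 1) i j = ϖ ^ D * T i j := fun i j => by simp only [hTdef, mul_inv_cancel_left₀ hϖD0]
  have hyσ : ∀ i, Valued.v (σ (y i)) ≤ 1 := fun i => by rw [hvσ]; exact hy i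
  -- the product of the off-diagonal residues is a unit: `tr² − 4det = ϖ^{2D}((t₀₀ − t₁₁)² + 4 t₀₁ t₁₀)`
  have hg : ∀ i j, g i j = (1 : Matrix (Fin 2) (Fin 2) K) i j + ϖ ^ D * T i j := fun i j => by
    rw [← hsub, Matrix.sub_apply]; ring
  have hdisc_eq : g.trace ^ 2 - 4 * g.det = (ϖ ^ D) ^ 2 * ((T 0 0 - T 1 1) ^ 2 + 4 * (T 0 1 * T 1 0)) := by
    rw [Matrix.trace_fin_two, Matrix.det_fin_two, hg 0 0, hg 0 1, hg 1 0, hg 1 1]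
    simp only [Matrix.one_apply_eq, Matrix.one_apply_ne (show (0 : Fin 2) ≠ 1 by decide), Matrix.one_apply_ne (show (1 : Fin 2) ≠ 0 by decide)]
    ring
  have hoff : Valued.v (T 0 1 * T 1 0) = 1 := by
    have h1 : Valued.v ((T 0 0 - T 1 1) ^ 2 + 4 * (T 0 1 * T 1 0)) = 1 := by
      have := hdisc
      rw [hdisc_eq, map_mul, map_pow, map_pow, ← pow_mul, mul_comm D 2] at this
      have hpos : (Valued.v ϖ ^ (2 * D)) ≠ 0 := pow_ne_zero _ ((Valuation.ne_zero_iff _).2 hϖ0)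
      exact mul_left_cancel₀ hpos (by rw [this, mul_one])
    have hsm : Valued.v ((T 0 0 - T 1 1) ^ 2) < 1 := by
      rw [map_pow]; exact pow_lt_one₀ zero_le ((Valued.v.map_sub _ _).trans_lt (max_lt hT00 hT11)) two_ne_zero
    have h4 : Valued.v (4 : K) = 1 := by rw [show (4 : K) = 2 * 2 by norm_num, map_mul, h2, one_mul]
    have : 4 * (T 0 1 * T 1 0) = ((T 0 0 - T 1 1) ^ 2 + 4 * (T 0 1 * T 1 0)) - (T 0 0 - T 1 1) ^ 2 := by ring
    have h5 : Valued.v (4 * (T 0 1 * T 1 0)) = 1 := by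
      rw [this, Valuation.map_sub_eq_of_lt_left _ (by rw [h1]; exact hsm), h1]
    rwa [map_mul, h4, one_mul] at h5
  -- the expansion: `⟨y,(g−1)²y⟩ = ϖ^{2D}·(t₀₁t₁₀·⟨y,y⟩ + E)` with `E` carrying a factor `t₀₀`, `t₁₁` or `t₀₀ + t₁₁`
  have hexp : pairing σ (Matrix.diagonal d) y (((g - 1) ^ 2) *ᵥ y) =
      (ϖ ^ D) ^ 2 * (T 0 1 * T 1 0 * pairing σ (Matrix.diagonal d) y y +
        (d 0 * σ (y 0) * y 0 * T 0 0 ^ 2 + d 1 * σ (y 1) * y 1 * T 1 1 ^ 2 +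
          d 0 * σ (y 0) * y 1 * (T 0 1 * (T 0 0 + T 1 1)) + d 1 * σ (y 1) * y 0 * (T 1 0 * (T 0 0 + T 1 1)))) := by
    simp only [pairing_apply, Fin.sum_univ_two, Matrix.mulVec, dotProduct, Matrix.diagonal_apply_eq, sq, Matrix.mul_apply,
      Matrix.diagonal_apply_ne _ (show (0 : Fin 2) ≠ 1 by decide), Matrix.diagonal_apply_ne _ (show (1 : Fin 2) ≠ 0 by decide), hsub,
      mul_zero, zero_mul, add_zero, zero_add]
    ring
  rw [hexp, map_mul, map_pow, map_pow, ← pow_mul, mul_comm D 2]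
  suffices hmain : Valued.v (T 0 1 * T 1 0 * pairing σ (Matrix.diagonal d) y y +
        (d 0 * σ (y 0) * y 0 * T 0 0 ^ 2 + d 1 * σ (y 1) * y 1 * T 1 1 ^ 2 +
          d 0 * σ (y 0) * y 1 * (T 0 1 * (T 0 0 + T 1 1)) + d 1 * σ (y 1) * y 0 * (T 1 0 * (T 0 0 + T 1 1)))) = 1 by
    rw [hmain, mul_one]
  have hlead : Valued.v (T 0 1 * T 1 0 * pairing σ (Matrix.diagonal d) y y) = 1 := by rw [map_mul, hoff, hyy, one_mul]
  have hsum : Valued.v (T 0 0 + T 1 1) < 1 := (Valued.v.map_add _ _).trans_lt (max_lt hT00 hT11)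
  have e1 : Valued.v (d 0 * σ (y 0) * y 0 * T 0 0 ^ 2) < 1 := by
    rw [map_mul, map_pow, mul_comm]
    refine mul_lt_one_of_lt_of_le (pow_lt_one₀ zero_le hT00 two_ne_zero) ?_
    rw [map_mul, map_mul, hd 0, one_mul]; exact mul_le_one' (hyσ 0) (hy 0)
  have e2 : Valued.v (d 1 * σ (y 1) * y 1 * T 1 1 ^ 2) < 1 := by
    rw [map_mul, map_pow, mul_comm]
    refine mul_lt_one_of_lt_of_le (pow_lt_one₀ zero_le hT11 two_ne_zero) ?_
    rw [map_mul, map_mul, hd 1, one_mul]; exact mul_le_one' (hyσ 1) (hy 1)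
  have e3 : Valued.v (d 0 * σ (y 0) * y 1 * (T 0 1 * (T 0 0 + T 1 1))) < 1 := by
    rw [map_mul, mul_comm]
    refine mul_lt_one_of_lt_of_le (by rw [map_mul, mul_comm]; exact mul_lt_one_of_lt_of_le hsum (hT 0 1)) ?_
    rw [map_mul, map_mul, hd 0, one_mul]; exact mul_le_one' (hyσ 0) (hy 1)
  have e4 : Valued.v (d 1 * σ (y 1) * y 0 * (T 1 0 * (T 0 0 + T 1 1))) < 1 := by
    rw [map_mul, mul_comm]
    refine mul_lt_one_of_lt_of_le (by rw [map_mul, mul_comm]; exact mul_lt_one_of_lt_of_le hsum (hT 1 0)) ?_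
    rw [map_mul, map_mul, hd 1, one_mul]; exact mul_le_one' (hyσ 1) (hy 0)
  have hE : Valued.v (d 0 * σ (y 0) * y 0 * T 0 0 ^ 2 + d 1 * σ (y 1) * y 1 * T 1 1 ^ 2 +
          d 0 * σ (y 0) * y 1 * (T 0 1 * (T 0 0 + T 1 1)) + d 1 * σ (y 1) * y 0 * (T 1 0 * (T 0 0 + T 1 1))) < 1 :=
    (Valued.v.map_add _ _).trans_lt (max_lt ((Valued.v.map_add _ _).trans_lt (max_lt ((Valued.v.map_add _ _).trans_lt (max_lt e1 e2)) e3)) e4)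
  rw [Valuation.map_add_eq_of_lt_left _ (by rw [hlead]; exact hE), hlead]

/-- **NO `LEV₂(ϖ^{2D−1})` ON A COLLAR LATTICE AT THE BOTTOM** (the `O`-versus-`P^±` clause): if `w` has integral pairings (`w ⊆ w^♯`) and contains `x₀` with `ϖx₀ ∈ 𝒪³` of
unit W-norm `|⟨x_W,x_W⟩_{diag d}| = 1` (the collar generator of ★ `exists_generator_of_anisotropicRoot_sandwich`), and the block is at the bottom (`|tr²−4det| = |ϖ|^{2D}`,
residually vanishing diagonal, line part `|u₀₀ − 1| < |ϖ|^D`), then NOT `(ι(g,u) − 1)²·w ⊆ ϖ^{2D−1}·w`: on `z = ϖx₀` the value `⟨z,(Γ−1)²z⟩` has valuation EXACTLY `|ϖ|^{2D}`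
(`v_pairing_sub_one_sq_eq_of_bottom` + the line term `< |ϖ|^{2D}`), whereas the level token and integrality would give `≤ |ϖ|^{2D+1}`.
[cite: Kottwitz1986, §3] [cite: BruhatTits1972, §10] [cite: Rogawski1990, §4.9 Prop. 4.9.1 (b) p. 55] -/
theorem not_forall_sub_one_sq_mulVec_mem_scaleLattice_of_bottom (hvσ : ∀ a, Valued.v (σ a) = Valued.v a)
    (hϖ : Valued.v ϖ = WithZero.exp (-1 : ℤ)) (h2 : Valued.v (2 : K) = 1)
    {d : Fin 2 → K} (hd : ∀ i, Valued.v (d i) = 1) {η : K} (hη : Valued.v η ≤ 1)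
    (g : GL (Fin 2) K) (u : GL (Fin 1) K) {D : ℕ}
    (hdeep : ∀ i j, Valued.v (((g : Matrix (Fin 2) (Fin 2) K) - 1) i j) ≤ Valued.v ϖ ^ D)
    (hdiag : ∀ i, Valued.v ((ϖ ^ D)⁻¹ * ((g : Matrix (Fin 2) (Fin 2) K) - 1) i i) < 1)
    (hdisc : Valued.v ((g : Matrix (Fin 2) (Fin 2) K).trace ^ 2 - 4 * (g : Matrix (Fin 2) (Fin 2) K).det) = Valued.v ϖ ^ (2 * D))
    (hu : Valued.v ((u : Matrix (Fin 1) (Fin 1) K) 0 0 - 1) < Valued.v ϖ ^ D) (hD1 : 1 ≤ D)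
    {w : Submodule 𝒪[K] (Fin 3 → K)}
    (hint : ∀ a ∈ w, ∀ b ∈ w, Valued.v (pairing σ (!![(Matrix.diagonal d) 0 0, 0, (Matrix.diagonal d) 0 1; 0, η, 0; (Matrix.diagonal d) 1 0, 0, (Matrix.diagonal d) 1 1] : Matrix (Fin 3) (Fin 3) K) a b) ≤ 1)
    {x₀ : Fin 3 → K} (hx₀ : x₀ ∈ w) (hz : ∀ i, Valued.v ((ϖ • x₀) i) ≤ 1)
    (hzW : Valued.v (pairing σ (Matrix.diagonal d) (![(ϖ • x₀) 0, (ϖ • x₀) 2] : Fin 2 → K) ![(ϖ • x₀) 0, (ϖ • x₀) 2]) = 1) :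
    ¬ ∀ y ∈ w, ((((endoGL (g, u) : GL (Fin 3) K) : Matrix (Fin 3) (Fin 3) K) - 1) ^ 2) *ᵥ y ∈ scaleLattice (ϖ ^ (2 * D - 1)) w := by
  intro hall
  have hϖ0 : ϖ ≠ 0 := fun h0 => by rw [h0, map_zero] at hϖ; exact WithZero.coe_ne_zero hϖ.symm
  have hϖ1 : Valued.v ϖ < 1 := by rw [hϖ, ← WithZero.exp_zero]; exact WithZero.exp_lt_exp.2 (by norm_num)
  have hϖv0 : Valued.v ϖ ≠ 0 := (Valuation.ne_zero_iff _).2 hϖ0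
  set Hb : Matrix (Fin 3) (Fin 3) K := !![(Matrix.diagonal d) 0 0, 0, (Matrix.diagonal d) 0 1; 0, η, 0; (Matrix.diagonal d) 1 0, 0, (Matrix.diagonal d) 1 1] with hHb
  set A : Matrix (Fin 3) (Fin 3) K := (((endoGL (g, u) : GL (Fin 3) K) : Matrix (Fin 3) (Fin 3) K) - 1) ^ 2 with hA
  -- (C2) the value on `z = ϖ•x₀` has valuation EXACTLY `|ϖ|^{2D}`
  have hexact : Valued.v (pairing σ Hb (ϖ • x₀) (A *ᵥ (ϖ • x₀))) = Valued.v ϖ ^ (2 * D) := by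
    rw [hA, hHb, coe_endoGL_sub_one_sq_eq_endoShape, pairing_endoShape_mulVec_endoShape]
    have hW := v_pairing_sub_one_sq_eq_of_bottom hvσ hϖ h2 hd (g : Matrix (Fin 2) (Fin 2) K) hdeep hdiag hdisc ![(ϖ • x₀) 0, (ϖ • x₀) 2]
      (fun i => by fin_cases i; exacts [by simpa using hz 0, by simpa using hz 2]) hzW
    have hsmall : Valued.v (σ ((ϖ • x₀) 1) * η * ((((u : Matrix (Fin 1) (Fin 1) K) 0 0 - 1) ^ 2) * (ϖ • x₀) 1)) < Valued.v ϖ ^ (2 * D) := by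
      rw [map_mul, map_mul, map_mul, map_pow, hvσ]
      calc Valued.v ((ϖ • x₀) 1) * Valued.v η * (Valued.v (((u : Matrix (Fin 1) (Fin 1) K) 0 0 - 1)) ^ 2 * Valued.v ((ϖ • x₀) 1))
          ≤ 1 * 1 * (Valued.v (((u : Matrix (Fin 1) (Fin 1) K) 0 0 - 1)) ^ 2 * 1) := by gcongr; exacts [hz 1, hz 1]
        _ = Valued.v (((u : Matrix (Fin 1) (Fin 1) K) 0 0 - 1)) ^ 2 := by rw [one_mul, one_mul, mul_one]
        _ < (Valued.v ϖ ^ D) ^ 2 := by exact pow_lt_pow_left₀ hu zero_le two_ne_zero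
        _ = Valued.v ϖ ^ (2 * D) := by rw [← pow_mul, mul_comm]
    rw [Valuation.map_add_eq_of_lt_left _ (by rw [hW]; exact hsmall), hW]
  -- the LEV₂ token would make it `≤ |ϖ|^{2D+1}`
  have hm := hall x₀ hx₀
  rw [mem_scaleLattice_iff (pow_ne_zero _ hϖ0)] at hm
  set m : Fin 3 → K := (ϖ ^ (2 * D - 1))⁻¹ • (A *ᵥ x₀) with hmdef
  have hAx : A *ᵥ x₀ = (ϖ ^ (2 * D - 1)) • m := by rw [hmdef, smul_inv_smul₀ (pow_ne_zero _ hϖ0)]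
  have hpair : pairing σ Hb (ϖ • x₀) (A *ᵥ (ϖ • x₀)) = σ ϖ * (ϖ * (ϖ ^ (2 * D - 1) * pairing σ Hb x₀ m)) := by
    rw [Matrix.mulVec_smul, hAx]
    simp only [map_smul, LinearMap.map_smulₛₗ, LinearMap.smul_apply, smul_eq_mul]
    ring
  have hle : Valued.v (pairing σ Hb (ϖ • x₀) (A *ᵥ (ϖ • x₀))) ≤ Valued.v ϖ ^ (2 * D + 1) := by
    rw [hpair, map_mul, map_mul, map_mul, hvσ, map_pow]
    have hexp : Valued.v ϖ * (Valued.v ϖ * (Valued.v ϖ ^ (2 * D - 1) * 1)) = Valued.v ϖ ^ (2 * D + 1) := by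
      rw [mul_one, ← pow_succ', ← pow_succ']; congr 1; omega
    calc Valued.v ϖ * (Valued.v ϖ * (Valued.v ϖ ^ (2 * D - 1) * Valued.v (pairing σ Hb x₀ m)))
        ≤ Valued.v ϖ * (Valued.v ϖ * (Valued.v ϖ ^ (2 * D - 1) * 1)) := by gcongr; exact hint x₀ hx₀ m hm
      _ = Valued.v ϖ ^ (2 * D + 1) := hexp
  rw [hexact] at hle
  have : Valued.v ϖ ^ (2 * D + 1) < Valued.v ϖ ^ (2 * D) := pow_lt_pow_right_of_lt_one₀ (zero_lt_iff.2 hϖv0) hϖ1 (by omega)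
  exact absurd (hle.trans_lt this) (lt_irrefl _)

/-! ## §3 Assembly in the block model (set currency): the tokens of every self-dual lattice two steps from the root -/

/-- Pointwise ⇒ map form of a level token (converse of ★ `forall_mulVec_mem_scaleLattice_of_map_le`). [cite: BruhatTits1972, §10] -/
theorem map_toLin'_le_scaleLattice_of_forall_mulVec_mem {N : ℕ} (A : Matrix (Fin N) (Fin N) K) (c : K) (M : Submodule 𝒪[K] (Fin N → K))
    (h : ∀ x ∈ M, A *ᵥ x ∈ scaleLattice c M) : M.map ((Matrix.toLin' A).restrictScalars 𝒪[K]) ≤ scaleLattice c M := by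
  rintro _ ⟨x, hx, rfl⟩
  rw [LinearMap.restrictScalars_apply, Matrix.toLin'_apply]
  exact h x hx

/-- At the bottom with residually vanishing diagonal, the OFF-DIAGONAL entries of `g − 1` have EXACT valuation `|ϖ|^D` (`|t₀₁t₁₀| = 1`). [cite: Kottwitz1986, §3] [cite: Rogawski1990, §4.9 Lemma 4.9.3 p. 56] -/
theorem v_sub_one_apply_zero_one_eq_of_bottom (hϖ : Valued.v ϖ = WithZero.exp (-1 : ℤ)) (h2 : Valued.v (2 : K) = 1)
    (g : Matrix (Fin 2) (Fin 2) K) {D : ℕ} (hdeep : ∀ i j, Valued.v ((g - 1) i j) ≤ Valued.v ϖ ^ D)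
    (hdiag : ∀ i, Valued.v ((ϖ ^ D)⁻¹ * (g - 1) i i) < 1)
    (hdisc : Valued.v (g.trace ^ 2 - 4 * g.det) = Valued.v ϖ ^ (2 * D)) :
    Valued.v ((g - 1) 0 1) = Valued.v ϖ ^ D := by
  have hϖ0 : ϖ ≠ 0 := fun h0 => by rw [h0, map_zero] at hϖ; exact WithZero.coe_ne_zero hϖ.symm
  have hϖD0 : (ϖ ^ D : K) ≠ 0 := pow_ne_zero _ hϖ0
  have hvD : Valued.v ((ϖ ^ D)⁻¹ : K) * Valued.v ϖ ^ D = 1 := by rw [← map_pow, ← map_mul, inv_mul_cancel₀ hϖD0, map_one]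
  set T : Fin 2 → Fin 2 → K := fun i j => (ϖ ^ D)⁻¹ * (g - 1) i j with hTdef
  have hT : ∀ i j, Valued.v (T i j) ≤ 1 := fun i j => by
    simp only [hTdef]; rw [map_mul]
    calc Valued.v ((ϖ ^ D)⁻¹ : K) * Valued.v ((g - 1) i j) ≤ Valued.v ((ϖ ^ D)⁻¹ : K) * Valued.v ϖ ^ D := by gcongr; exact hdeep i j
      _ = 1 := hvD
  have hsub : ∀ i j, (g - 1) i j = ϖ ^ D * T i j := fun i j => by simp only [hTdef, mul_inv_cancel_left₀ hϖD0]
  have hg : ∀ i j, g i j = (1 : Matrix (Fin 2) (Fin 2) K) i j + ϖ ^ D * T i j := fun i j => by rw [← hsub, Matrix.sub_apply]; ring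
  have hdisc_eq : g.trace ^ 2 - 4 * g.det = (ϖ ^ D) ^ 2 * ((T 0 0 - T 1 1) ^ 2 + 4 * (T 0 1 * T 1 0)) := by
    rw [Matrix.trace_fin_two, Matrix.det_fin_two, hg 0 0, hg 0 1, hg 1 0, hg 1 1]
    simp only [Matrix.one_apply_eq, Matrix.one_apply_ne (show (0 : Fin 2) ≠ 1 by decide), Matrix.one_apply_ne (show (1 : Fin 2) ≠ 0 by decide)]
    ring
  have h1 : Valued.v ((T 0 0 - T 1 1) ^ 2 + 4 * (T 0 1 * T 1 0)) = 1 := by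
    have := hdisc
    rw [hdisc_eq, map_mul, map_pow, map_pow, ← pow_mul, mul_comm D 2] at this
    exact mul_left_cancel₀ (pow_ne_zero _ ((Valuation.ne_zero_iff _).2 hϖ0)) (by rw [this, mul_one])
  have hsm : Valued.v ((T 0 0 - T 1 1) ^ 2) < 1 := by
    rw [map_pow]; exact pow_lt_one₀ zero_le ((Valued.v.map_sub _ _).trans_lt (max_lt (hdiag 0) (hdiag 1))) two_ne_zero
  have h4 : Valued.v (4 : K) = 1 := by rw [show (4 : K) = 2 * 2 by norm_num, map_mul, h2, one_mul]
  have heq : 4 * (T 0 1 * T 1 0) = ((T 0 0 - T 1 1) ^ 2 + 4 * (T 0 1 * T 1 0)) - (T 0 0 - T 1 1) ^ 2 := by ring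
  have h5 : Valued.v (T 0 1 * T 1 0) = 1 := by
    have h6 : Valued.v (4 * (T 0 1 * T 1 0)) = 1 := by rw [heq, Valuation.map_sub_eq_of_lt_left _ (by rw [h1]; exact hsm), h1]
    rwa [map_mul, h4, one_mul] at h6
  have h01 : Valued.v (T 0 1) = 1 := by
    refine le_antisymm (hT 0 1) ?_
    by_contra hlt
    rw [not_le] at hlt
    have : Valued.v (T 0 1 * T 1 0) < 1 := by rw [map_mul]; exact mul_lt_one_of_lt_of_le hlt (hT 1 0)
    exact absurd h5 this.ne
  rw [hsub, map_mul, h01, mul_one, map_pow]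

/-- The `ι`-shaped form `ι(diag d, η)` with unit `d, η` has unit determinant. [cite: Rogawski1990, §4.8 Case (a) p. 53] -/
theorem isUnit_det_endoShape_diagonal {d : Fin 2 → K} (hd : ∀ i, Valued.v (d i) = 1) {η : K} (hη : Valued.v η = 1) :
    IsUnit ((!![(Matrix.diagonal d) 0 0, 0, (Matrix.diagonal d) 0 1; 0, η, 0; (Matrix.diagonal d) 1 0, 0, (Matrix.diagonal d) 1 1] : Matrix (Fin 3) (Fin 3) K)).det := by
  rw [isUnit_iff_ne_zero, Matrix.det_fin_three]
  have hd0 : d 0 ≠ 0 := fun h0 => by have := hd 0; rw [h0, map_zero] at this; exact zero_ne_one this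
  have hd1 : d 1 ≠ 0 := fun h0 => by have := hd 1; rw [h0, map_zero] at this; exact zero_ne_one this
  have hη0 : η ≠ 0 := fun h0 => by rw [h0, map_zero] at hη; exact zero_ne_one hη
  simp [hd0, hd1, hη0]

/-- The root `L₀ = 𝒪³` has level `D` for `ι(γ₁,u) − 1` when the blocks do (pointwise form, the `hlev` binder of ★ (L2)). [cite: BruhatTits1972, §10] [cite: Kottwitz1986, §3] -/
theorem forall_endoGL_sub_one_mulVec_mem_scaleLattice_stdLattice (hϖ : Valued.v ϖ = WithZero.exp (-1 : ℤ)) (γ₁ : GL (Fin 2) K) (u : GL (Fin 1) K) {D : ℕ}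
    (hdeep : ∀ i j, Valued.v (((γ₁ : Matrix (Fin 2) (Fin 2) K) - 1) i j) ≤ Valued.v ϖ ^ D) (hu : Valued.v ((u : Matrix (Fin 1) (Fin 1) K) 0 0 - 1) ≤ Valued.v ϖ ^ D) :
    ∀ a ∈ stdLattice K 3, (((endoGL (γ₁, u) : GL (Fin 3) K) : Matrix (Fin 3) (Fin 3) K) - 1) *ᵥ a ∈ scaleLattice (ϖ ^ D) (stdLattice K 3) := by
  intro a ha
  have hϖ0 : ϖ ≠ 0 := fun h0 => by rw [h0, map_zero] at hϖ; exact WithZero.coe_ne_zero hϖ.symm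
  have hϖD0 : (ϖ ^ D : K) ≠ 0 := pow_ne_zero _ hϖ0
  have hvD : Valued.v ((ϖ ^ D)⁻¹ : K) * Valued.v ϖ ^ D = 1 := by rw [← map_pow, ← map_mul, inv_mul_cancel₀ hϖD0, map_one]
  rw [mem_stdLattice] at ha
  rw [mem_scaleLattice_iff hϖD0, mem_stdLattice]
  intro i
  rw [Pi.smul_apply, smul_eq_mul, map_mul]
  have hbound : ∀ t : K, Valued.v t ≤ Valued.v ϖ ^ D → Valued.v ((ϖ ^ D)⁻¹ : K) * Valued.v t ≤ 1 := fun t ht =>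
    calc Valued.v ((ϖ ^ D)⁻¹ : K) * Valued.v t ≤ Valued.v ((ϖ ^ D)⁻¹ : K) * Valued.v ϖ ^ D := by gcongr
      _ = 1 := hvD
  apply hbound
  rw [coe_endoGL_sub_one_eq_endoShape]
  fin_cases i
  · simp only [Matrix.mulVec, dotProduct, Fin.sum_univ_three, Fin.zero_eta, Matrix.of_apply, Matrix.cons_val', Matrix.cons_val_zero, Matrix.cons_val_one,
      Matrix.cons_val_two, Matrix.empty_val', Matrix.cons_val_fin_one, Matrix.head_cons, Matrix.tail_cons, zero_mul, add_zero]
    refine (Valued.v.map_add _ _).trans (max_le ?_ ?_)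
    · rw [map_mul]; exact (mul_le_mul' (hdeep 0 0) (ha 0)).trans (by rw [mul_one])
    · rw [map_mul]; exact (mul_le_mul' (hdeep 0 1) (ha 2)).trans (by rw [mul_one])
  · simp only [Matrix.mulVec, dotProduct, Fin.sum_univ_three, Fin.mk_one, Matrix.of_apply, Matrix.cons_val', Matrix.cons_val_zero, Matrix.cons_val_one,
      Matrix.cons_val_two, Matrix.empty_val', Matrix.cons_val_fin_one, Matrix.head_cons, Matrix.tail_cons, zero_mul, add_zero, zero_add]
    rw [map_mul]; exact (mul_le_mul' hu (ha 1)).trans (by rw [mul_one])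
  · simp only [Matrix.mulVec, dotProduct, Fin.sum_univ_three, Fin.reduceFinMk, Matrix.of_apply, Matrix.cons_val', Matrix.cons_val_zero, Matrix.cons_val_one,
      Matrix.cons_val_two, Matrix.empty_val', Matrix.cons_val_fin_one, Matrix.head_cons, Matrix.tail_cons, Matrix.head_fin_const, zero_mul, add_zero]
    refine (Valued.v.map_add _ _).trans (max_le ?_ ?_)
    · rw [map_mul]; exact (mul_le_mul' (hdeep 1 0) (ha 0)).trans (by rw [mul_one])
    · rw [map_mul]; exact (mul_le_mul' (hdeep 1 1) (ha 2)).trans (by rw [mul_one])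

set_option maxHeartbeats 800000 in
-- budget only: statement-heavy block tokens.
/-- **(§3) THE TOKENS OF EVERY ROOT GRANDCHILD OF THE ANISOTROPIC LITERAL AT EVEN DEPTH (block model, set currency).**  `H = ι(diag d, η)` anisotropic, `Γ = ι(γ₁, u)`,
`γ₁ ∈ U(σ, diag d)` with ROOTLESS characteristic polynomial, EVEN `D ≥ 2` with `|γ₁ − 1| ≤ |ϖ|^D`, line part `|u₀₀ − 1| < |ϖ|^D` (the `u`-line deeper: regime A) and
the block AT THE BOTTOM `|tr² − 4det| = |ϖ|^{2D}`; principal units are squares (`hsq`, ★ `exists_sq_eq_of_valued_sub_one_lt` at the CM place).  Then EVERY self-dual `Γ`-fixed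
lattice `w ≠ L₀` with `ϖL₀ ≤ w`, `ϖw ≤ L₀` (the root's grandchildren, ★ (L2)) satisfies, in map form: **`¬LEV_w(ϖ^D)`** (★ p08 singleton root region), **`LEV_w(ϖ^{D−1})`** (§1 +
★ (L2) `anisotropicRoot_fixed_and_lev_iff`), **`LEV_w(ϖ^{D−2})`** (★ (L2)), **`¬LEV₂,w(ϖ^{2D−1})`** (§2) — i.e. `w` carries the token `O` of ★ p848934 ∕ p848995 and none of
`E`, `P^±`. [cite: Kottwitz1986, §3] [cite: BruhatTits1972, §10] [cite: LabesseLanglands1979, §2] [cite: Rogawski1990, §4.9 Prop. 4.9.1 (b) p. 55, Lemma 4.9.3 p. 56] -/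
theorem anisotropicRoot_tokens_of_even_bottom [IsPrincipalIdealRing 𝒪[K]] (σ : K →+* K) (hσ : ∀ a, σ (σ a) = a) (hvσ : ∀ a, Valued.v (σ a) = Valued.v a)
    {ϖ : K} (hσϖ : σ ϖ = -ϖ) (hϖ : Valued.v ϖ = WithZero.exp (-1 : ℤ)) (hres : ∀ x : K, Valued.v x ≤ 1 → Valued.v (σ x - x) < 1) (h2 : Valued.v (2 : K) = 1)
    (hsq : ∀ t : K, Valued.v (t - 1) < 1 → IsSquare t)
    {d : Fin 2 → K} (hd : ∀ i, Valued.v (d i) = 1) (hdσ : ∀ i, σ (d i) = d i)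
    (hanis₀ : ∀ c : K, Valued.v c ≤ 1 → Valued.v (d 0 + d 1 * (σ c * c)) = 1)
    (hanis₁ : ∀ c : K, Valued.v c ≤ 1 → Valued.v (d 0 * (σ c * c) + d 1) = 1)
    {η : K} (hη : Valued.v η = 1) (hησ : σ η = η)
    (γ₁ : GL (Fin 2) K) (u : GL (Fin 1) K) (hγU : γ₁ ∈ unitaryGroupOfForm σ (Matrix.diagonal d))
    (hirr : ∀ x : K, ¬ (γ₁ : Matrix (Fin 2) (Fin 2) K).charpoly.IsRoot x)
    {D : ℕ} (hD : Even D) (hD2 : 2 ≤ D)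
    (hdeep : ∀ i j, Valued.v (((γ₁ : Matrix (Fin 2) (Fin 2) K) - 1) i j) ≤ Valued.v ϖ ^ D)
    (hu : Valued.v ((u : Matrix (Fin 1) (Fin 1) K) 0 0 - 1) < Valued.v ϖ ^ D)
    (hdisc : Valued.v ((γ₁ : Matrix (Fin 2) (Fin 2) K).trace ^ 2 - 4 * (γ₁ : Matrix (Fin 2) (Fin 2) K).det) = Valued.v ϖ ^ (2 * D))
    {w : Submodule 𝒪[K] (Fin 3 → K)} (hw : IsSelfDualLattice σ ϖ (!![(Matrix.diagonal d) 0 0, 0, (Matrix.diagonal d) 0 1; 0, η, 0; (Matrix.diagonal d) 1 0, 0, (Matrix.diagonal d) 1 1] : Matrix (Fin 3) (Fin 3) K) w)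
    (hfix0 : mapGL (endoGL (γ₁, u)) (stdLattice K 3) = stdLattice K 3) (hfix : mapGL (endoGL (γ₁, u)) w = w)
    (hLw : scaleLattice (ϖ ^ 1) (stdLattice K 3) ≤ w) (hwL : scaleLattice (ϖ ^ 1) w ≤ stdLattice K 3) (hne : w ≠ stdLattice K 3) :
    ¬ w.map ((Matrix.toLin' (((endoGL (γ₁, u) : GL (Fin 3) K) : Matrix (Fin 3) (Fin 3) K) - 1)).restrictScalars 𝒪[K]) ≤ scaleLattice (ϖ ^ D) w ∧
    w.map ((Matrix.toLin' (((endoGL (γ₁, u) : GL (Fin 3) K) : Matrix (Fin 3) (Fin 3) K) - 1)).restrictScalars 𝒪[K]) ≤ scaleLattice (ϖ ^ (D - 1)) w ∧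
    w.map ((Matrix.toLin' (((endoGL (γ₁, u) : GL (Fin 3) K) : Matrix (Fin 3) (Fin 3) K) - 1)).restrictScalars 𝒪[K]) ≤ scaleLattice (ϖ ^ (D - 2)) w ∧
    ¬ w.map ((Matrix.toLin' ((((endoGL (γ₁, u) : GL (Fin 3) K) : Matrix (Fin 3) (Fin 3) K) - 1) ^ 2)).restrictScalars 𝒪[K]) ≤ scaleLattice (ϖ ^ (2 * D - 1)) w := by
  have hϖ0 : ϖ ≠ 0 := fun h0 => by rw [h0, map_zero] at hϖ; exact WithZero.coe_ne_zero hϖ.symm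
  have hϖD0 : (ϖ ^ D : K) ≠ 0 := pow_ne_zero _ hϖ0
  have hD0 : D ≠ 0 := by omega
  have hpos : 0 < Valued.v ϖ ^ D := by rw [← map_pow]; exact zero_lt_iff.2 ((Valuation.ne_zero_iff _).2 hϖD0)
  -- the root has level `D`
  have hlev := forall_endoGL_sub_one_mulVec_mem_scaleLattice_stdLattice hϖ γ₁ u hdeep hu.le
  -- §1: the residual diagonal and the value vanish
  obtain ⟨hdiag, hW⟩ := v_pairing_diagonal_sub_one_lt_of_even hσ hvσ hσϖ hϖ hres h2 hd (γ₁ : Matrix (Fin 2) (Fin 2) K) hγU hD hD0 hdeep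
  have hu' : Valued.v ((ϖ ^ D)⁻¹ * ((u : Matrix (Fin 1) (Fin 1) K) 0 0 - 1)) < 1 := by
    rw [map_mul, map_inv₀, map_pow]
    calc (Valued.v ϖ ^ D)⁻¹ * Valued.v ((u : Matrix (Fin 1) (Fin 1) K) 0 0 - 1) < (Valued.v ϖ ^ D)⁻¹ * Valued.v ϖ ^ D := by
          exact mul_lt_mul_of_pos_left hu (inv_pos.2 hpos)
      _ = 1 := inv_mul_cancel₀ hpos.ne'
  -- ★ (L2): the collar generator and the level tokens
  obtain ⟨_, x₀, hx₀, hx₀1, hzint, _, _, hzW, _, _⟩ :=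
    exists_generator_of_anisotropicRoot_sandwich σ hσ hvσ hϖ hd hdσ hanis₀ hanis₁ hη hησ hw hLw hwL hne
  obtain ⟨_, hlev2, hlev1⟩ := anisotropicRoot_fixed_and_lev_iff σ hσ hvσ hϖ hd hdσ hanis₀ hanis₁ hη hησ γ₁ u hD2 hlev hw hLw hwL hne hx₀ hx₀1
  have hz : ∀ i, Valued.v ((ϖ • x₀) i) ≤ 1 := fun i => (mem_stdLattice.1 hzint) i
  refine ⟨?_, ?_, map_toLin'_le_scaleLattice_of_forall_mulVec_mem _ _ _ hlev2, ?_⟩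
  · -- ¬LEV(ϖ^D): the root region is `{L₀}` (★ p08)
    intro hlevD
    have hA' : ∃ i j, Valued.v ϖ ^ D ≤ Valued.v (((γ₁ : Matrix (Fin 2) (Fin 2) K) - (u : Matrix (Fin 1) (Fin 1) K) 0 0 • (1 : Matrix (Fin 2) (Fin 2) K)) i j) := by
      refine ⟨0, 1, ?_⟩
      have : ((γ₁ : Matrix (Fin 2) (Fin 2) K) - (u : Matrix (Fin 1) (Fin 1) K) 0 0 • (1 : Matrix (Fin 2) (Fin 2) K)) 0 1 = ((γ₁ : Matrix (Fin 2) (Fin 2) K) - 1) 0 1 := by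
        simp [Matrix.sub_apply, Matrix.one_apply_ne (show (0 : Fin 2) ≠ 1 by decide)]
      rw [this, v_sub_one_apply_zero_one_eq_of_bottom hϖ h2 _ hdeep hdiag hdisc]
    have hT := nonContraction_of_unitary_anisotropic_of_entry hvσ h2 hsq hd hanis₀ hanis₁ γ₁ hγU hirr u hA'
    have hroot : (stdLattice K 3).map ((Matrix.toLin' (((endoGL (γ₁, u) : GL (Fin 3) K) : Matrix (Fin 3) (Fin 3) K) - 1)).restrictScalars 𝒪[K]) ≤ scaleLattice (ϖ ^ D) (stdLattice K 3) :=
      map_toLin'_le_scaleLattice_of_forall_mulVec_mem _ _ _ hlev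
    have hset := setOf_selfDual_fixed_lev_eq_singleton_of_anisotropic σ hσ hvσ hϖ hd hdσ hanis₀ hanis₁ hη hησ γ₁ u hT hfix0 hroot
    have hmem : w ∈ ({M : Submodule 𝒪[K] (Fin 3 → K) |
        IsSelfDualLattice σ ϖ (!![(Matrix.diagonal d) 0 0, 0, (Matrix.diagonal d) 0 1; 0, η, 0; (Matrix.diagonal d) 1 0, 0, (Matrix.diagonal d) 1 1] : Matrix (Fin 3) (Fin 3) K) M ∧ mapGL (endoGL (γ₁, u)) M = M ∧
        M.map ((Matrix.toLin' (((endoGL (γ₁, u) : GL (Fin 3) K) : Matrix (Fin 3) (Fin 3) K) - 1)).restrictScalars 𝒪[K]) ≤ scaleLattice (ϖ ^ D) M} : Set (Submodule 𝒪[K] (Fin 3 → K))) := ⟨hw, hfix, hlevD⟩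
    rw [hset, Set.mem_singleton_iff] at hmem
    exact hne hmem
  · -- LEV(ϖ^{D−1}): the value vanishes at even depth
    exact map_toLin'_le_scaleLattice_of_forall_mulVec_mem _ _ _
      (hlev1.2 (v_inv_pow_mul_pairing_endoShape_lt_one hη.le hvσ γ₁ u hW hu' (ϖ • x₀) hz))
  · -- ¬LEV₂(ϖ^{2D−1}): the bottom
    intro hsqle
    have hint : ∀ a ∈ w, ∀ b ∈ w, Valued.v (pairing σ (!![(Matrix.diagonal d) 0 0, 0, (Matrix.diagonal d) 0 1; 0, η, 0; (Matrix.diagonal d) 1 0, 0, (Matrix.diagonal d) 1 1] : Matrix (Fin 3) (Fin 3) K) a b) ≤ 1 := by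
      intro a ha b hb
      have hb' : b ∈ dualLatt σ (!![(Matrix.diagonal d) 0 0, 0, (Matrix.diagonal d) 0 1; 0, η, 0; (Matrix.diagonal d) 1 0, 0, (Matrix.diagonal d) 1 1] : Matrix (Fin 3) (Fin 3) K) w := by rw [dualLatt_eq_self_of_isSelfDualLattice hvσ (isUnit_det_endoShape_diagonal hd hη) hw]; exact hb
      exact (mem_dualLatt σ _ w b).1 hb' a ha
    exact not_forall_sub_one_sq_mulVec_mem_scaleLattice_of_bottom hvσ hϖ h2 hd hη.le γ₁ u hdeep hdiag hdisc hu (by omega) hint hx₀ hz hzW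
      (forall_mulVec_mem_scaleLattice_of_map_le _ _ _ hsqle)

/-! ## §4 The `Φ₃`∕`J₀`-model census of the anisotropic literal `P·ι(γ₁,u)·P⁻¹` at even root depth: `NE = NP = NM = 0`, the `O`-set is the whole grandchild set -/

set_option maxHeartbeats 1600000 in
-- budget only: statement-heavy lattice tokens (the ★ even head's set-builders verbatim).
/-- **(§4) THE A-EVEN ANISOTROPIC ⟨stdLattice K 3, 0, isSelfDualLattice_stdLattice_three_of_v hϖ⟩ CENSUS in ★ `strataCount_J₀_of_charpoly_block_even_singleton`'s own currency.**  For `γ = P·ι(γ₁,u)·P⁻¹ ∈ U(σ, J₀) ∩ K₀` with the frame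
`ᵗσ(P)J₀P = ι(diag d, η)` (anisotropic unit data), `P·L₀ = L₀`, and the block data of §3 (EVEN `d₀ ≥ 2`, `|γ₁ − 1| ≤ |ϖ|^{d₀}`, `|u₀₀ − 1| < |ϖ|^{d₀}`, bottom
`|tr²−4det| = |ϖ|^{2d₀}`, rootless `charpoly γ₁`, principal units squares): among the `γ`-fixed grandchildren of the root `r₀` — the ★ head's set `GC(r₀)` — the `E`-, `P`- and
`M`-token sets are EMPTY and the `O`-token set is ALL of `GC(r₀)`; stated as the four `ncard` identities feeding `hNE hNO hNP hNM` with `(NE, NO, NP, NM) := (0, #GC(r₀), 0, 0)`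
(set-builders CHARACTER-EQUAL to ★ p848995's).  Transport `J₀ ↔ ι(diag d, η)` along `M ↦ P⁻¹M` as in ★ p08 §3 (`isSelfDualLattice_formCongr_iff`, `map_conj_sub_one[_sq]_le_scaleLattice_iff`,
`mapGL_conj_mapGL_eq_iff`); self-duality and the sandwich of a grandchild from the `J₀`-graph (★ alternation, ★ `scaleLattice_le_of_adj_adj_of_isSelfDualLattice`).
[cite: Kottwitz1986, §3] [cite: BruhatTits1972, §10] [cite: Rogawski1990, §4.9 Prop. 4.9.1 (b) p. 55, Lemma 4.9.3 p. 56] -/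
theorem anisotropicRoot_even_census_of_coe_eq_conj_endoGL [IsPrincipalIdealRing 𝒪[K]]
    (hσ : ∀ a, σ (σ a) = a) (hvσ : ∀ a, Valued.v (σ a) = Valued.v a) (hσϖ : σ ϖ = -ϖ) (hϖ : Valued.v ϖ = WithZero.exp (-1 : ℤ))
    (hres : ∀ x : K, Valued.v x ≤ 1 → Valued.v (σ x - x) < 1) (h2 : Valued.v (2 : K) = 1) (hsq : ∀ t : K, Valued.v (t - 1) < 1 → IsSquare t)
    {d : Fin 2 → K} {η : K} (P : GL (Fin 3) K)
    (hP : formCongr σ P ((StdForm.antidiagonal 3).over K) = (!![(Matrix.diagonal d) 0 0, 0, (Matrix.diagonal d) 0 1; 0, η, 0; (Matrix.diagonal d) 1 0, 0, (Matrix.diagonal d) 1 1] : Matrix (Fin 3) (Fin 3) K))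
    (hP0 : mapGL P (stdLattice K 3) = stdLattice K 3)
    (hd : ∀ i, Valued.v (d i) = 1) (hdσ : ∀ i, σ (d i) = d i)
    (hanis₀ : ∀ c : K, Valued.v c ≤ 1 → Valued.v (d 0 + d 1 * (σ c * c)) = 1)
    (hanis₁ : ∀ c : K, Valued.v c ≤ 1 → Valued.v (d 0 * (σ c * c) + d 1) = 1)
    (hησ : σ η = η) (hη : Valued.v η = 1)
    (γ : unitaryGroupOfForm σ ((StdForm.antidiagonal 3).over K)) (hγ0 : γ ∈ unitaryInt σ ((StdForm.antidiagonal 3).over K))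
    (γ₁ : GL (Fin 2) K) (u : GL (Fin 1) K) (hγ : (γ : GL (Fin 3) K) = P * endoGL (γ₁, u) * P⁻¹)
    (hγU : γ₁ ∈ unitaryGroupOfForm σ (Matrix.diagonal d)) (hirr : ∀ x : K, ¬ (γ₁ : Matrix (Fin 2) (Fin 2) K).charpoly.IsRoot x)
    {d₀ : ℕ} (hD : Even d₀) (hD2 : 2 ≤ d₀)
    (hdeep : ∀ i j, Valued.v (((γ₁ : Matrix (Fin 2) (Fin 2) K) - 1) i j) ≤ Valued.v ϖ ^ d₀)
    (hu : Valued.v ((u : Matrix (Fin 1) (Fin 1) K) 0 0 - 1) < Valued.v ϖ ^ d₀)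
    (hdisc : Valued.v ((γ₁ : Matrix (Fin 2) (Fin 2) K).trace ^ 2 - 4 * (γ₁ : Matrix (Fin 2) (Fin 2) K).det) = Valued.v ϖ ^ (2 * d₀)) (c₁ : K) :
    ({w | w ∈ {w | ∃ c, ((latticeGraph σ ϖ ((StdForm.antidiagonal 3).over K)).Adj (⟨stdLattice K 3, 0, isSelfDualLattice_stdLattice_three_of_v hϖ⟩ : {M : Submodule 𝒪[K] (Fin 3 → K) // IsVertex σ ϖ ((StdForm.antidiagonal 3).over K) M}) c ∧ (latticeGraph σ ϖ ((StdForm.antidiagonal 3).over K)).dist ⟨stdLattice K 3, 0, isSelfDualLattice_stdLattice_three_of_v hϖ⟩ c = (latticeGraph σ ϖ ((StdForm.antidiagonal 3).over K)).dist ⟨stdLattice K 3, 0, isSelfDualLattice_stdLattice_three_of_v hϖ⟩ (⟨stdLattice K 3, 0, isSelfDualLattice_stdLattice_three_of_v hϖ⟩ : {M : Submodule 𝒪[K] (Fin 3 → K) // IsVertex σ ϖ ((StdForm.antidiagonal 3).over K) M}) + 1 ∧ latticeGraphIso σ ϖ ((StdForm.antidiagonal 3).over K) γ c = c) ∧ ((latticeGraph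 σ ϖ ((StdForm.antidiagonal 3).over K)).Adj c w ∧ (latticeGraph σ ϖ ((StdForm.antidiagonal 3).over K)).dist ⟨stdLattice K 3, 0, isSelfDualLattice_stdLattice_three_of_v hϖ⟩ w = (latticeGraph σ ϖ ((StdForm.antidiagonal 3).over K)).dist ⟨stdLattice K 3, 0, isSelfDualLattice_stdLattice_three_of_v hϖ⟩ c + 1 ∧ latticeGraphIso σ ϖ ((StdForm.antidiagonal 3).over K) γ w = w)} ∧ (¬ w.1.map ((Matrix.toLin' (((γ : GL (Fin 3) K) : Matrix (Fin 3) (Fin 3) K) - 1)).restrictScalars 𝒪[K]) ≤ scaleLattice (ϖ ^ d₀) w.1 ∧ (w.1.map ((Matrix.toLin' (((γ : GL (Fin 3) K) : Matrix (Fin 3) (Fin 3) K) - 1)).restrictScalars 𝒪[K]) ≤ scaleLattice (ϖ ^ (d₀ - 2)) w.1 ∧ ¬ w.1.map ((Matrix.toLin' (((γ : GL (Fin 3) K) : Matrix (Fin 3) (Fin 3) K) - 1)).restrictScalars 𝒪[K]) ≤ scaleLattice (ϖ ^ (d₀ - 1)) w.1))}).ncard = 0 ∧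
    ({w | w ∈ {w | ∃ c, ((latticeGraph σ ϖ ((StdForm.antidiagonal 3).over K)).Adj (⟨stdLattice K 3, 0, isSelfDualLattice_stdLattice_three_of_v hϖ⟩ : {M : Submodule 𝒪[K] (Fin 3 → K) // IsVertex σ ϖ ((StdForm.antidiagonal 3).over K) M}) c ∧ (latticeGraph σ ϖ ((StdForm.antidiagonal 3).over K)).dist ⟨stdLattice K 3, 0, isSelfDualLattice_stdLattice_three_of_v hϖ⟩ c = (latticeGraph σ ϖ ((StdForm.antidiagonal 3).over K)).dist ⟨stdLattice K 3, 0, isSelfDualLattice_stdLattice_three_of_v hϖ⟩ (⟨stdLattice K 3, 0, isSelfDualLattice_stdLattice_three_of_v hϖ⟩ : {M : Submodule 𝒪[K] (Fin 3 → K) // IsVertex σ ϖ ((StdForm.antidiagonal 3).over K) M}) + 1 ∧ latticeGraphIso σ ϖ ((StdForm.antidiagonal 3).over K) γ c = c) ∧ ((latticeGraph σ ϖ ((StdForm.antidiagonal 3).over K)).Adj c w ∧ (latticeGraph σ ϖ ((StdForm.antidiagonal 3).over K)).dist ⟨stdLattice K 3, 0, isSelfDualLattice_stdLattice_three_of_v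 hϖ⟩ w = (latticeGraph σ ϖ ((StdForm.antidiagonal 3).over K)).dist ⟨stdLattice K 3, 0, isSelfDualLattice_stdLattice_three_of_v hϖ⟩ c + 1 ∧ latticeGraphIso σ ϖ ((StdForm.antidiagonal 3).over K) γ w = w)} ∧ (¬ w.1.map ((Matrix.toLin' (((γ : GL (Fin 3) K) : Matrix (Fin 3) (Fin 3) K) - 1)).restrictScalars 𝒪[K]) ≤ scaleLattice (ϖ ^ d₀) w.1 ∧ (w.1.map ((Matrix.toLin' (((γ : GL (Fin 3) K) : Matrix (Fin 3) (Fin 3) K) - 1)).restrictScalars 𝒪[K]) ≤ scaleLattice (ϖ ^ (d₀ - 1)) w.1 ∧ ¬ w.1.map ((Matrix.toLin' (((γ : GL (Fin 3) K) : Matrix (Fin 3) (Fin 3) K) - 1)).restrictScalars 𝒪[K]) ≤ scaleLattice (ϖ ^ d₀) w.1) ∧ ¬ w.1.map ((Matrix.toLin' ((((γ : GL (Fin 3) K) : Matrix (Fin 3) (Fin 3) K) - 1) ^ 2)).restrictScalars 𝒪[K]) ≤ scaleLattice (ϖ ^ (2 * d₀ - 1)) w.1)}).ncard = ({w | w ∈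 {w | ∃ c, ((latticeGraph σ ϖ ((StdForm.antidiagonal 3).over K)).Adj (⟨stdLattice K 3, 0, isSelfDualLattice_stdLattice_three_of_v hϖ⟩ : {M : Submodule 𝒪[K] (Fin 3 → K) // IsVertex σ ϖ ((StdForm.antidiagonal 3).over K) M}) c ∧ (latticeGraph σ ϖ ((StdForm.antidiagonal 3).over K)).dist ⟨stdLattice K 3, 0, isSelfDualLattice_stdLattice_three_of_v hϖ⟩ c = (latticeGraph σ ϖ ((StdForm.antidiagonal 3).over K)).dist ⟨stdLattice K 3, 0, isSelfDualLattice_stdLattice_three_of_v hϖ⟩ (⟨stdLattice K 3, 0, isSelfDualLattice_stdLattice_three_of_v hϖ⟩ : {M : Submodule 𝒪[K] (Fin 3 → K) // IsVertex σ ϖ ((StdForm.antidiagonal 3).over K) M}) + 1 ∧ latticeGraphIso σ ϖ ((StdForm.antidiagonal 3).over K) γ c = c) ∧ ((latticeGraph σ ϖ ((StdForm.antidiagonal 3).over K)).Adj c w ∧ (latticeGraph σ ϖ ((StdForm.antidiagonal 3).over K)).dist ⟨stdLattice K 3, 0, isSelfDualLattice_stdLattice_three_of_v hϖ⟩ w =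 (latticeGraph σ ϖ ((StdForm.antidiagonal 3).over K)).dist ⟨stdLattice K 3, 0, isSelfDualLattice_stdLattice_three_of_v hϖ⟩ c + 1 ∧ latticeGraphIso σ ϖ ((StdForm.antidiagonal 3).over K) γ w = w)}}).ncard ∧
    ({w | w ∈ {w | ∃ c, ((latticeGraph σ ϖ ((StdForm.antidiagonal 3).over K)).Adj (⟨stdLattice K 3, 0, isSelfDualLattice_stdLattice_three_of_v hϖ⟩ : {M : Submodule 𝒪[K] (Fin 3 → K) // IsVertex σ ϖ ((StdForm.antidiagonal 3).over K) M}) c ∧ (latticeGraph σ ϖ ((StdForm.antidiagonal 3).over K)).dist ⟨stdLattice K 3, 0, isSelfDualLattice_stdLattice_three_of_v hϖ⟩ c = (latticeGraph σ ϖ ((StdForm.antidiagonal 3).over K)).dist ⟨stdLattice K 3, 0, isSelfDualLattice_stdLattice_three_of_v hϖ⟩ (⟨stdLattice K 3, 0, isSelfDualLattice_stdLattice_three_of_v hϖ⟩ : {M : Submodule 𝒪[K] (Fin 3 → K) // IsVertex σ ϖ ((StdForm.antidiagonal 3).over K) M}) + 1 ∧ latticeGraphIso σ ϖ ((StdForm.antidiagonal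 3).over K) γ c = c) ∧ ((latticeGraph σ ϖ ((StdForm.antidiagonal 3).over K)).Adj c w ∧ (latticeGraph σ ϖ ((StdForm.antidiagonal 3).over K)).dist ⟨stdLattice K 3, 0, isSelfDualLattice_stdLattice_three_of_v hϖ⟩ w = (latticeGraph σ ϖ ((StdForm.antidiagonal 3).over K)).dist ⟨stdLattice K 3, 0, isSelfDualLattice_stdLattice_three_of_v hϖ⟩ c + 1 ∧ latticeGraphIso σ ϖ ((StdForm.antidiagonal 3).over K) γ w = w)} ∧ (¬ w.1.map ((Matrix.toLin' (((γ : GL (Fin 3) K) : Matrix (Fin 3) (Fin 3) K) - 1)).restrictScalars 𝒪[K]) ≤ scaleLattice (ϖ ^ d₀) w.1 ∧ (w.1.map ((Matrix.toLin' (((γ : GL (Fin 3) K) : Matrix (Fin 3) (Fin 3) K) - 1)).restrictScalars 𝒪[K]) ≤ scaleLattice (ϖ ^ (d₀ - 1)) w.1 ∧ ¬ w.1.map ((Matrix.toLin' (((γ : GL (Fin 3) K) : Matrix (Fin 3) (Fin 3) K) - 1)).restrictScalars 𝒪[K]) ≤ scaleLattice (ϖ ^ d₀) w.1) ∧ w.1.map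 ((Matrix.toLin' ((((γ : GL (Fin 3) K) : Matrix (Fin 3) (Fin 3) K) - 1) ^ 2)).restrictScalars 𝒪[K]) ≤ scaleLattice (ϖ ^ (2 * d₀ - 1)) w.1 ∧ ∃ y ∈ w.1, ∃ a : K, Valued.v a = 1 ∧ Valued.v ((ϖ ^ (d₀ - 1))⁻¹ * pairing σ ((StdForm.antidiagonal 3).over K) y ((((γ : GL (Fin 3) K) : Matrix (Fin 3) (Fin 3) K) - 1) *ᵥ y) - (c₁) * a ^ 2) < 1)}).ncard = 0 ∧
    ({w | w ∈ {w | ∃ c, ((latticeGraph σ ϖ ((StdForm.antidiagonal 3).over K)).Adj (⟨stdLattice K 3, 0, isSelfDualLattice_stdLattice_three_of_v hϖ⟩ : {M : Submodule 𝒪[K] (Fin 3 → K) // IsVertex σ ϖ ((StdForm.antidiagonal 3).over K) M}) c ∧ (latticeGraph σ ϖ ((StdForm.antidiagonal 3).over K)).dist ⟨stdLattice K 3, 0, isSelfDualLattice_stdLattice_three_of_v hϖ⟩ c = (latticeGraph σ ϖ ((StdForm.antidiagonal 3).over K)).dist ⟨stdLattice K 3, 0, isSelfDualLattice_stdLattice_three_of_v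 hϖ⟩ (⟨stdLattice K 3, 0, isSelfDualLattice_stdLattice_three_of_v hϖ⟩ : {M : Submodule 𝒪[K] (Fin 3 → K) // IsVertex σ ϖ ((StdForm.antidiagonal 3).over K) M}) + 1 ∧ latticeGraphIso σ ϖ ((StdForm.antidiagonal 3).over K) γ c = c) ∧ ((latticeGraph σ ϖ ((StdForm.antidiagonal 3).over K)).Adj c w ∧ (latticeGraph σ ϖ ((StdForm.antidiagonal 3).over K)).dist ⟨stdLattice K 3, 0, isSelfDualLattice_stdLattice_three_of_v hϖ⟩ w = (latticeGraph σ ϖ ((StdForm.antidiagonal 3).over K)).dist ⟨stdLattice K 3, 0, isSelfDualLattice_stdLattice_three_of_v hϖ⟩ c + 1 ∧ latticeGraphIso σ ϖ ((StdForm.antidiagonal 3).over K) γ w = w)} ∧ (¬ w.1.map ((Matrix.toLin' (((γ : GL (Fin 3) K) : Matrix (Fin 3) (Fin 3) K) - 1)).restrictScalars 𝒪[K]) ≤ scaleLattice (ϖ ^ d₀) w.1 ∧ (w.1.map ((Matrix.toLin' (((γ : GL (Fin 3) K) : Matrix (Fin 3) (Fin 3) K) - 1)).restrictScalars 𝒪[K])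 ≤ scaleLattice (ϖ ^ (d₀ - 1)) w.1 ∧ ¬ w.1.map ((Matrix.toLin' (((γ : GL (Fin 3) K) : Matrix (Fin 3) (Fin 3) K) - 1)).restrictScalars 𝒪[K]) ≤ scaleLattice (ϖ ^ d₀) w.1) ∧ w.1.map ((Matrix.toLin' ((((γ : GL (Fin 3) K) : Matrix (Fin 3) (Fin 3) K) - 1) ^ 2)).restrictScalars 𝒪[K]) ≤ scaleLattice (ϖ ^ (2 * d₀ - 1)) w.1 ∧ ¬ (∃ y ∈ w.1, ∃ a : K, Valued.v a = 1 ∧ Valued.v ((ϖ ^ (d₀ - 1))⁻¹ * pairing σ ((StdForm.antidiagonal 3).over K) y ((((γ : GL (Fin 3) K) : Matrix (Fin 3) (Fin 3) K) - 1) *ᵥ y) - (c₁) * a ^ 2) < 1))}).ncard = 0 := by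
  -- per grandchild: the four tokens of §3 transported along `P`
  have key : ∀ x : {M : Submodule 𝒪[K] (Fin 3 → K) // IsVertex σ ϖ ((StdForm.antidiagonal 3).over K) M}, x ∈ ({w | w ∈ {w | ∃ c, ((latticeGraph σ ϖ ((StdForm.antidiagonal 3).over K)).Adj (⟨stdLattice K 3, 0, isSelfDualLattice_stdLattice_three_of_v hϖ⟩ : {M : Submodule 𝒪[K] (Fin 3 → K) // IsVertex σ ϖ ((StdForm.antidiagonal 3).over K) M}) c ∧ (latticeGraph σ ϖ ((StdForm.antidiagonal 3).over K)).dist ⟨stdLattice K 3, 0, isSelfDualLattice_stdLattice_three_of_v hϖ⟩ c = (latticeGraph σ ϖ ((StdForm.antidiagonal 3).over K)).dist ⟨stdLattice K 3, 0, isSelfDualLattice_stdLattice_three_of_v hϖ⟩ (⟨stdLattice K 3, 0, isSelfDualLattice_stdLattice_three_of_v hϖ⟩ : {M : Submodule 𝒪[K] (Fin 3 → K) // IsVertex σ ϖ ((StdForm.antidiagonal 3).over K) M}) + 1 ∧ latticeGraphIso σ ϖ ((StdForm.antidiagonal 3).over K) γ c = c) ∧ ((latticeGraph σ ϖ ((StdForm.antidiagonal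 3).over K)).Adj c w ∧ (latticeGraph σ ϖ ((StdForm.antidiagonal 3).over K)).dist ⟨stdLattice K 3, 0, isSelfDualLattice_stdLattice_three_of_v hϖ⟩ w = (latticeGraph σ ϖ ((StdForm.antidiagonal 3).over K)).dist ⟨stdLattice K 3, 0, isSelfDualLattice_stdLattice_three_of_v hϖ⟩ c + 1 ∧ latticeGraphIso σ ϖ ((StdForm.antidiagonal 3).over K) γ w = w)}}) →
      ¬ x.1.map ((Matrix.toLin' (((γ : GL (Fin 3) K) : Matrix (Fin 3) (Fin 3) K) - 1)).restrictScalars 𝒪[K]) ≤ scaleLattice (ϖ ^ d₀) x.1 ∧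
      x.1.map ((Matrix.toLin' (((γ : GL (Fin 3) K) : Matrix (Fin 3) (Fin 3) K) - 1)).restrictScalars 𝒪[K]) ≤ scaleLattice (ϖ ^ (d₀ - 1)) x.1 ∧
      x.1.map ((Matrix.toLin' (((γ : GL (Fin 3) K) : Matrix (Fin 3) (Fin 3) K) - 1)).restrictScalars 𝒪[K]) ≤ scaleLattice (ϖ ^ (d₀ - 2)) x.1 ∧
      ¬ x.1.map ((Matrix.toLin' ((((γ : GL (Fin 3) K) : Matrix (Fin 3) (Fin 3) K) - 1) ^ 2)).restrictScalars 𝒪[K]) ≤ scaleLattice (ϖ ^ (2 * d₀ - 1)) x.1 := by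
    intro x hx
    simp only [Set.mem_setOf_eq] at hx
    obtain ⟨c, ⟨hrc, -, -⟩, hcx, hdist, hfixx⟩ := hx
    -- self-duality and the sandwich from the `J₀`-graph
    have hrS : IsSelfDualLattice σ ϖ ((StdForm.antidiagonal 3).over K) (⟨stdLattice K 3, 0, isSelfDualLattice_stdLattice_three_of_v hϖ⟩ : {M : Submodule 𝒪[K] (Fin 3 → K) // IsVertex σ ϖ ((StdForm.antidiagonal 3).over K) M}).1 :=
      isSelfDualLattice_stdLattice_three_of_v hϖ
    have hcS : ¬ IsSelfDualLattice σ ϖ ((StdForm.antidiagonal 3).over K) c.1 := (isSelfDualLattice_iff_not_isSelfDualLattice_of_adj_of_v hvσ hϖ hrc).1 hrS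
    have hxS : IsSelfDualLattice σ ϖ ((StdForm.antidiagonal 3).over K) x.1 := by
      by_contra hxS'
      exact hcS ((isSelfDualLattice_iff_not_isSelfDualLattice_of_adj_of_v hvσ hϖ hcx).2 hxS')
    obtain ⟨hLx, hxL⟩ := scaleLattice_le_of_adj_adj_of_isSelfDualLattice hvσ hrS hxS hrc hcx
    have hxne : x.1 ≠ stdLattice K 3 := by
      intro hx1
      have hxr : x = ⟨stdLattice K 3, 0, isSelfDualLattice_stdLattice_three_of_v hϖ⟩ := Subtype.ext hx1
      rw [hxr, SimpleGraph.dist_self] at hdist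
      have hc0 : (latticeGraph σ ϖ ((StdForm.antidiagonal 3).over K)).dist ⟨stdLattice K 3, 0, isSelfDualLattice_stdLattice_three_of_v hϖ⟩ c = 0 := by omega
      rw [SimpleGraph.dist_eq_zero_iff_eq_or_not_reachable] at hc0
      rcases hc0 with hc0 | hc0
      · exact hrc.ne hc0
      · exact hc0 hrc.reachable
    -- move to the block model along `M ↦ P⁻¹·M`
    set M' : Submodule 𝒪[K] (Fin 3 → K) := mapGL P⁻¹ x.1 with hM'
    have hx1 : x.1 = mapGL P M' := by rw [hM', ← mapGL_mul, mul_inv_cancel, mapGL_one]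
    have hSD' : IsSelfDualLattice σ ϖ (!![(Matrix.diagonal d) 0 0, 0, (Matrix.diagonal d) 0 1; 0, η, 0; (Matrix.diagonal d) 1 0, 0, (Matrix.diagonal d) 1 1] : Matrix (Fin 3) (Fin 3) K) M' := by
      rw [← hP, isSelfDualLattice_formCongr_iff, ← hx1]; exact hxS
    have hP0' : mapGL P⁻¹ (stdLattice K 3) = stdLattice K 3 := by
      conv_lhs => rw [← hP0]
      rw [mapGL_inv_mapGL]
    have hLw : scaleLattice (ϖ ^ 1) (stdLattice K 3) ≤ M' := by
      rw [pow_one, ← hP0', ← mapGL_scaleLattice, hM', mapGL_le_mapGL_iff]; exact hLx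
    have hwL : scaleLattice (ϖ ^ 1) M' ≤ stdLattice K 3 := by
      rw [pow_one, ← hP0', hM', ← mapGL_scaleLattice, mapGL_le_mapGL_iff]; exact hxL
    have hne' : M' ≠ stdLattice K 3 := by
      intro h; apply hxne; rw [hx1, h, hP0]
    have hγm : ((γ : GL (Fin 3) K) : Matrix (Fin 3) (Fin 3) K) = (((P * endoGL (γ₁, u) * P⁻¹ : GL (Fin 3) K)) : Matrix (Fin 3) (Fin 3) K) := by rw [hγ]
    have hfix' : mapGL (endoGL (γ₁, u)) M' = M' := by
      rw [← mapGL_conj_mapGL_eq_iff P, ← hx1, ← hγ]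
      have := congrArg Subtype.val hfixx
      rwa [latticeGraphIso_apply_val] at this
    have hfix0 : mapGL (endoGL (γ₁, u)) (stdLattice K 3) = stdLattice K 3 := by
      rw [← mapGL_conj_mapGL_eq_iff P, hP0, ← hγ]
      exact mapGL_stdLattice_of_mem_unitaryInt hγ0
    obtain ⟨t1, t2, t3, t4⟩ := anisotropicRoot_tokens_of_even_bottom σ hσ hvσ hσϖ hϖ hres h2 hsq hd hdσ hanis₀ hanis₁ hη hησ γ₁ u hγU hirr hD hD2 hdeep hu hdisc
      hSD' hfix0 hfix' hLw hwL hne'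
    refine ⟨?_, ?_, ?_, ?_⟩
    · rw [hx1, hγm, map_conj_sub_one_le_scaleLattice_iff]; exact t1
    · rw [hx1, hγm, map_conj_sub_one_le_scaleLattice_iff]; exact t2
    · rw [hx1, hγm, map_conj_sub_one_le_scaleLattice_iff]; exact t3
    · rw [hx1, hγm, map_conj_sub_one_sq_le_scaleLattice_iff]; exact t4
  refine ⟨?_, ?_, ?_, ?_⟩
  · refine Eq.trans (congrArg Set.ncard (Set.eq_empty_iff_forall_notMem.2 fun x hx => ?_)) (Set.ncard_empty _)
    obtain ⟨hGC, -, -, hn1⟩ := hx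
    exact hn1 (key x hGC).2.1
  · congr 1
    ext x
    constructor
    · exact fun h => h.1
    · intro hx
      obtain ⟨k1, k2, -, k4⟩ := key x hx
      exact ⟨hx, k1, ⟨k2, k1⟩, k4⟩
  · refine Eq.trans (congrArg Set.ncard (Set.eq_empty_iff_forall_notMem.2 fun x hx => ?_)) (Set.ncard_empty _)
    obtain ⟨hGC, -, -, hsq2, -⟩ := hx
    exact (key x hGC).2.2.2 hsq2
  · refine Eq.trans (congrArg Set.ncard (Set.eq_empty_iff_forall_notMem.2 fun x hx => ?_)) (Set.ncard_empty _)
    obtain ⟨hGC, -, -, hsq2, -⟩ := hx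
    exact (key x hGC).2.2.2 hsq2

/-! ## §5 (ED. 2) The number of root grandchildren of a `2`-deep element: `#GC(r₀) = (q+1)·q` -/

/-- **`#GC(r₀) = (q + 1)·q` for `γ ∈ K₀` with `γ ≡ 1 (mod ϖ²)`** — the closed value of the atom `NO = #GC(r₀)` of §4 (and of the odd aniso cell's `NE + NP + NM`): ★ ROW-⟨stdLattice K 3, 0, isSelfDualLattice_stdLattice_three_of_v hϖ⟩-SLICE
`ncard_rootGrandchildren_sep_eq_mul_ncard_of_congr_sq` with the trivial predicate (every slice passes, `q` fixed grandchildren behind each of the `q + 1` children of the root, ★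
`ncard_neighborSet_root_of_ramified`); the grandchild set-builder is ★ p848995's (double `setOf` wrapper included). [cite: Kottwitz1986, §3] [cite: Serre1980Trees, I.2.3, II.1.1] [cite: BruhatTits1972, §10] -/
theorem ncard_rootGrandchildren_eq_of_congr_sq (hσ : ∀ x, σ (σ x) = x) (hvσ : ∀ a, Valued.v (σ a) = Valued.v a) (hσϖ : σ ϖ = -ϖ)
    (hϖ : Valued.v ϖ = WithZero.exp (-1 : ℤ)) (hres : ∀ x : K, Valued.v x ≤ 1 → Valued.v (σ x - x) < 1) (h2 : Valued.v (2 : K) = 1) [Finite 𝓀[K]]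
    (hT : (latticeGraph σ ϖ ((StdForm.antidiagonal 3).over K)).IsTree)
    {γ : unitaryGroupOfForm σ ((StdForm.antidiagonal 3).over K)} (hγ0 : γ ∈ unitaryInt σ ((StdForm.antidiagonal 3).over K))
    (hdeep : ∀ i j, Valued.v ((((γ : GL (Fin 3) K) : Matrix (Fin 3) (Fin 3) K) - 1) i j) ≤ Valued.v ϖ ^ 2) :
    ({w | w ∈ {w | ∃ c, ((latticeGraph σ ϖ ((StdForm.antidiagonal 3).over K)).Adj (⟨stdLattice K 3, 0, isSelfDualLattice_stdLattice_three_of_v hϖ⟩ : {M : Submodule 𝒪[K] (Fin 3 → K) // IsVertex σ ϖ ((StdForm.antidiagonal 3).over K) M}) c ∧ (latticeGraph σ ϖ ((StdForm.antidiagonal 3).over K)).dist ⟨stdLattice K 3, 0, isSelfDualLattice_stdLattice_three_of_v hϖ⟩ c = (latticeGraph σ ϖ ((StdForm.antidiagonal 3).over K)).dist ⟨stdLattice K 3, 0, isSelfDualLattice_stdLattice_three_of_v hϖ⟩ (⟨stdLattice K 3, 0, isSelfDualLattice_stdLattice_three_of_v hϖ⟩ : {M : Submodule 𝒪[K] (Fin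 3 → K) // IsVertex σ ϖ ((StdForm.antidiagonal 3).over K) M}) + 1 ∧ latticeGraphIso σ ϖ ((StdForm.antidiagonal 3).over K) γ c = c) ∧ ((latticeGraph σ ϖ ((StdForm.antidiagonal 3).over K)).Adj c w ∧ (latticeGraph σ ϖ ((StdForm.antidiagonal 3).over K)).dist ⟨stdLattice K 3, 0, isSelfDualLattice_stdLattice_three_of_v hϖ⟩ w = (latticeGraph σ ϖ ((StdForm.antidiagonal 3).over K)).dist ⟨stdLattice K 3, 0, isSelfDualLattice_stdLattice_three_of_v hϖ⟩ c + 1 ∧ latticeGraphIso σ ϖ ((StdForm.antidiagonal 3).over K) γ w = w)}}).ncard = (Nat.card 𝓀[K] + 1) * Nat.card 𝓀[K] := by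
  have hslice := ncard_rootGrandchildren_sep_eq_mul_ncard_of_congr_sq hσ hvσ hσϖ hϖ hres h2 hT hγ0 hdeep (fun _ => True) (fun _ _ _ _ _ _ _ _ => Iff.rfl)
  have hL : ({w | w ∈ {w | ∃ c, ((latticeGraph σ ϖ ((StdForm.antidiagonal 3).over K)).Adj (⟨stdLattice K 3, 0, isSelfDualLattice_stdLattice_three_of_v hϖ⟩ : {M : Submodule 𝒪[K] (Fin 3 → K) // IsVertex σ ϖ ((StdForm.antidiagonal 3).over K) M}) c ∧ (latticeGraph σ ϖ ((StdForm.antidiagonal 3).over K)).dist ⟨stdLattice K 3, 0, isSelfDualLattice_stdLattice_three_of_v hϖ⟩ c = (latticeGraph σ ϖ ((StdForm.antidiagonal 3).over K)).dist ⟨stdLattice K 3, 0, isSelfDualLattice_stdLattice_three_of_v hϖ⟩ (⟨stdLattice K 3, 0, isSelfDualLattice_stdLattice_three_of_v hϖ⟩ : {M : Submodule 𝒪[K] (Fin 3 → K) // IsVertex σ ϖ ((StdForm.antidiagonal 3).over K) M}) + 1 ∧ latticeGraphIso σ ϖ ((StdForm.antidiagonal 3).over K) γ c = c) ∧ ((latticeGraph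 σ ϖ ((StdForm.antidiagonal 3).over K)).Adj c w ∧ (latticeGraph σ ϖ ((StdForm.antidiagonal 3).over K)).dist ⟨stdLattice K 3, 0, isSelfDualLattice_stdLattice_three_of_v hϖ⟩ w = (latticeGraph σ ϖ ((StdForm.antidiagonal 3).over K)).dist ⟨stdLattice K 3, 0, isSelfDualLattice_stdLattice_three_of_v hϖ⟩ c + 1 ∧ latticeGraphIso σ ϖ ((StdForm.antidiagonal 3).over K) γ w = w)}}) = {w | w ∈ {w | ∃ c, ((latticeGraph σ ϖ ((StdForm.antidiagonal 3).over K)).Adj (⟨stdLattice K 3, 0, isSelfDualLattice_stdLattice_three_of_v hϖ⟩ : {M : Submodule 𝒪[K] (Fin 3 → K) // IsVertex σ ϖ ((StdForm.antidiagonal 3).over K) M}) c ∧ (latticeGraph σ ϖ ((StdForm.antidiagonal 3).over K)).dist ⟨stdLattice K 3, 0, isSelfDualLattice_stdLattice_three_of_v hϖ⟩ c = (latticeGraph σ ϖ ((StdForm.antidiagonal 3).over K)).dist ⟨stdLattice K 3, 0, isSelfDualLattice_stdLattice_three_of_v hϖ⟩ (⟨stdLattice K 3, 0, isSelfDualLattice_stdLattice_three_of_v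 hϖ⟩ : {M : Submodule 𝒪[K] (Fin 3 → K) // IsVertex σ ϖ ((StdForm.antidiagonal 3).over K) M}) + 1 ∧ latticeGraphIso σ ϖ ((StdForm.antidiagonal 3).over K) γ c = c) ∧ ((latticeGraph σ ϖ ((StdForm.antidiagonal 3).over K)).Adj c w ∧ (latticeGraph σ ϖ ((StdForm.antidiagonal 3).over K)).dist ⟨stdLattice K 3, 0, isSelfDualLattice_stdLattice_three_of_v hϖ⟩ w = (latticeGraph σ ϖ ((StdForm.antidiagonal 3).over K)).dist ⟨stdLattice K 3, 0, isSelfDualLattice_stdLattice_three_of_v hϖ⟩ c + 1 ∧ latticeGraphIso σ ϖ ((StdForm.antidiagonal 3).over K) γ w = w)} ∧ ((fun _ => True) w)} := by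
    ext w; simp only [Set.mem_setOf_eq, and_true]
  have hR : {c | (latticeGraph σ ϖ ((StdForm.antidiagonal 3).over K)).Adj ⟨stdLattice K 3, 0, isSelfDualLattice_stdLattice_three_of_v hϖ⟩ c ∧ ∀ w, (latticeGraph σ ϖ ((StdForm.antidiagonal 3).over K)).Adj c w → (latticeGraph σ ϖ ((StdForm.antidiagonal 3).over K)).dist ⟨stdLattice K 3, 0, isSelfDualLattice_stdLattice_three_of_v hϖ⟩ w = 2 → (fun _ => True) w} =
      (latticeGraph σ ϖ ((StdForm.antidiagonal 3).over K)).neighborSet ⟨stdLattice K 3, 0, isSelfDualLattice_stdLattice_three_of_v hϖ⟩ := by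
    ext c; simp only [Set.mem_setOf_eq, SimpleGraph.mem_neighborSet, implies_true, and_true]
  rw [hL, hslice, hR, ncard_neighborSet_root_of_ramified hσ hvσ hϖ hres h2 (isVertexLattice_two_N₁_of_neg hσϖ hϖ), mul_comm]

end Literature.NumberTheory.Automorphic.UnitaryLatticeTree

end
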